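import Literature.Topology.FourManifolds.OpenTraceCollar
import Literature.Topology.FourManifolds.SliceCollarProfile
import Literature.Topology.FourManifolds.SliceRibbon
import Literature.Topology.FourManifolds.SliceDiscEndCollarFacts
import Literature.Topology.FourManifolds.DehnSurgeryUniquenessProofs

/-!
# The end collar of a slice-disc exterior

Topic `Literature/Topology/FourManifolds`; fact seat of
`Literature.Topology.FourManifolds.Knot.ManolescuPiccirillo2023_lemma33_sphere` (Manolescu–Piccirillo (2023),
Lemma 3.3 for `W = S⁴`). This file reduces the leaf (V) of that fact,

  `Knot.IsSliceDisc.exists_endCollar_of_isIntegralSurgery_zero`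
  (`ZeroSurgeryHomotopyBallSliceConstruction.lean`: *the end of the exterior `B̊⁴ ∖ Δ` of a slice disc `Δ` of
  `K` is a product `Y × ℝ` for every `0`-surgery `Y` of `K`*, the printed "routine" `∂(B⁴ ∖ ν(Δ)) ≅ S³₀(K)`),

to the two classical normal-form facts of `SliceDiscEndCollarFacts.lean` (conical straightening of the
disc by a diffeomorphism of the open ball; framed conical tube with zero boundary framing):

* `Knot.IsSliceDisc.exists_endCollar_of_isIntegralSurgery_zero_of_facts :
    Knot.IsSliceDisc.exists_conical_diffeomorph → Knot.IsSliceDisc.exists_conicalTube_hasFraming_zero →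
    Knot.IsSliceDisc.exists_endCollar_of_isIntegralSurgery_zero`.

Everything else is an explicit construction, proved: for a datum `D : ConicalDiscTube K` (a slice disc
`g` conical on the band `1 - s₁ ≤ ‖x‖ ≤ 1`, an oriented tube `ν` of `K` of framing `0`, a trivialised tube
`G : D̊² × B(0,2) ↪ B̊⁴` of the open disc which is the cone `G(t u, w) = t • ν(u, w)` over the band and
keeps the deep part in `B̄(0, 1 - s₀)`) and a `3`-manifold `Y` glued from `S³ ∖ K` and `D̊² × 𝕊¹` along
`tubeSurgeryRel ν` (`TubeNbhd.IsSurgeryWith`, as in `OpenTraceCollar.lean`), the collar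

  `ConicalDiscTube.collarPH : OpenPartialHomeomorph (Y × ℝ) (sliceDiscExterior D.g)`

has source `Y × ℝ`, target the complement of the compact core
`K₀ = B̄(0, 1 - s₀) ∖ G(D̊² × B(0,1))`, is `C^∞` with `C^∞` inverse, `c(Y × (-∞, a])` is closed in the
exterior and `K₀ ∪ c(Y × [a, ∞))` is compact (`ConicalDiscTube.exists_endCollar`).

## The construction

It is the construction of `OpenTraceCollar.lean` (the open trace) with the corner-turning profile
`Ψ = (τ, h) : P(s₀) ≅ (0, 2) × ℝ` of `SliceCollarProfile.lean` in place of the trace profile. Three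
formulas on an open cover of `Y × ℝ` (`ConicalDiscTube.collar`):

* **radial** (`cRad`), over `jA(S³ ∖ ν(𝕊¹ × B̄(0,1)))`: `c(jA a, σ) = (1 - ℓ) • a`, depth
  `ℓ = Einv s₀ (e^{-σ}) ∈ (0, s₀)`;
* **tube** (`cTube`), over `jA(ν(𝕊¹ × (B(0,2) ∖ 0)))`: `c(jA (ν(u, w)), σ) = G((1 - ℓ) u, r ŵ)` with
  `(ℓ, r) = Ψ⁻¹(‖w‖, σ)` (agrees with the radial formula for `1 ≤ ‖w‖ < 2`, the right regime of `Ψ⁻¹`);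
* **flat** (`cFlat`), over `jB({‖p‖ < (1 - s₀)/4} × 𝕊¹)` (near the dual knot):
  `c(jB(p, v), σ) = G(4 p, Einv 1 (e^{-σ}) • v)` (the deep regime of `Ψ⁻¹`), the dual knot going to the
  normal rays over the centre of the disc.

The inverse (`collarInv`) is `z ↦ (jA ẑ, -log E_{s₀}(1 - ‖z‖))` on the radial region
`{‖z‖ > 1 - s₀, ẑ ∉ ν(𝕊¹ × B̄(0,1))}`, `G(x, w) ↦ (jA (ν (x̂, τ ŵ)), h)` with `(τ, h) = Ψ(1 - ‖x‖, ‖w‖)` in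
the tube, and `G(x, w) ↦ (jB(x/4, ŵ), -log E_1(‖w‖))` over the deep disc. We prove both inverse
identities (`collarInv_collar`, `collar_collarInv`), `range collar = B̊⁴ ∖ Δ ∖ K₀` (`range_collar`),
smoothness of both maps from the smoothness of the local formulas (`contMDiff_collar`,
`contMDiffOn_collarInv`), and the end clauses through the **size function**
`M = E_{s₀}(1 - ‖z‖) + E_1(‖w‖)` (`= e^{-σ}` on the collar region, `= 0` on the core, continuous on the
exterior; `image_collar_le`, `core_union_image_collar_ge`, `isCompact_setOf_M_le`). Finally the given
`0`-surgery is presented with the tube `ν` of the datum (`IsOpenGluing.surgeryRel_of_hasFraming`,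
`DehnSurgeryUniquenessProofs.lean`) and the collar is transported along the straightening diffeomorphism
(`exteriorHomeomorph`, `exists_endCollar_of_homeomorph`).

## References

* C. Manolescu, L. Piccirillo, *From zero surgeries to candidates for exotic definite 4-manifolds*,
  J. London Math. Soc. (2023), §3.2, proof of Lemma 3.3. [cite: ManolescuPiccirillo2023, §3.2 Def. 3.4]
* R. C. Kirby, *The Topology of 4-Manifolds*, LNM 1374 (1989), Ch. I §2 (zero framing), §5 (traces).
  [cite: Kirby1989, Ch. I §2]
* A. A. Kosinski, *Differential Manifolds* (1993), Ch. II (2.8.2), Ch. III (4.2). [cite: Kosinski1993, Ch. III Thm (4.2)]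

## Design notes

* The datum is bundled as the structure `ConicalDiscTube K`; the `Y`-side API (`TubeNbhd.jAt`, `jBt`, `ptY`,
  `invA`, `invB`, `IsSurgeryWith`, …) is reused from `OpenTraceCollar.lean`.
* No declaration in this file uses `sorry`; no instances; the local notations `𝔼 n`, `𝕊 n`, `𝔻²` are the
  topic's house idiom.
-/

open Set Real Metric Function
open scoped ContDiff Topology Manifold

noncomputable section

namespace Literature.Topology.FourManifolds

/-- Local notation: `𝔼 n` is the model Euclidean space `EuclideanSpace ℝ (Fin n)`. -/
local notation "𝔼 " n:arg => EuclideanSpace ℝ (Fin n)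

/-- Local notation: `𝕊 n` is the unit sphere in `EuclideanSpace ℝ (Fin (n + 1))`. -/
local notation "𝕊 " n:arg => (Metric.sphere (0 : EuclideanSpace ℝ (Fin (n + 1))) 1)

/-- Local notation: `𝔻²` is the closed unit disc in `ℝ²`. -/
local notation "𝔻²" => Metric.closedBall (0 : EuclideanSpace ℝ (Fin 2)) 1

/-! ### The data: a conical slice disc with a framed conical tube -/

/-- **a slice disc of `K` in conical normal form with a framed conical tube** (the conclusion of the named
facts `Knot.IsSliceDisc.exists_conical_diffeomorph` and `Knot.IsSliceDisc.exists_conicalTube_hasFraming_zero`) [folklore] -/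
structure ConicalDiscTube (K : Knot) where
  /-- the slice disc -/
  g : 𝔼 2 → 𝔼 4
  /-- the width of the conical band -/
  s₁ : ℝ
  /-- the depth of the compact core -/
  s₀ : ℝ
  /-- the tube of the knot in `S³` -/
  ν : Knot.TubularNbhd K
  /-- the trivialised tube of the disc -/
  G : (𝔼 2) × (𝔼 2) → 𝔼 4
  isSliceDisc : K.IsSliceDisc g
  s₀_pos : 0 < s₀
  s₀_lt : s₀ < s₁
  s₁_lt : s₁ < 1
  hasFraming : ν.HasFraming 0
  g_cone : ∀ (u : 𝕊 1) (t : ℝ), 1 - s₁ ≤ t → t ≤ 1 → g (t • (u : 𝔼 2)) = t • ((K u : 𝕊 3) : 𝔼 4)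
  contDiffOn : ContDiffOn ℝ ∞ G (ball (0 : 𝔼 2) 1 ×ˢ ball (0 : 𝔼 2) 2)
  injOn : InjOn G (ball (0 : 𝔼 2) 1 ×ˢ ball (0 : 𝔼 2) 2)
  injective_fderiv : ∀ q ∈ ball (0 : 𝔼 2) 1 ×ˢ ball (0 : 𝔼 2) 2, Injective (fderiv ℝ G q)
  maps_ball : ∀ q ∈ ball (0 : 𝔼 2) 1 ×ˢ ball (0 : 𝔼 2) 2, G q ∈ ball (0 : 𝔼 4) 1
  apply_zero : ∀ x ∈ ball (0 : 𝔼 2) 1, G (x, 0) = g x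
  cone : ∀ (u : 𝕊 1) (t : ℝ) (w : 𝔼 2), 1 - s₁ < t → t < 1 → ‖w‖ < 2 →
    G (t • (u : 𝔼 2), w) = t • ((ν (u, w) : 𝕊 3) : 𝔼 4)
  deep : ∀ (x w : 𝔼 2), ‖x‖ ≤ 1 - s₀ → ‖w‖ < 2 → ‖G (x, w)‖ ≤ 1 - s₀

namespace ConicalDiscTube

variable {K : Knot} (D : ConicalDiscTube K)

/-- `s₀ < 1`. [folklore] -/
theorem s₀_lt_one : D.s₀ < 1 := D.s₀_lt.trans D.s₁_lt

/-- `0 < s₁`. [folklore] -/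
theorem s₁_pos : 0 < D.s₁ := D.s₀_pos.trans D.s₀_lt

/-- The open domain `D̊² × B(0, 2)` of the disc tube [folklore] -/
def dom : Set ((𝔼 2) × (𝔼 2)) := ball (0 : 𝔼 2) 1 ×ˢ ball (0 : 𝔼 2) 2

/-- The domain of the disc tube is open. [folklore] -/
theorem isOpen_dom : IsOpen (dom : Set ((𝔼 2) × (𝔼 2))) := isOpen_ball.prod isOpen_ball

/-- Membership in the domain of the disc tube. [folklore] -/
theorem mem_dom_iff {q : (𝔼 2) × (𝔼 2)} : q ∈ (dom : Set ((𝔼 2) × (𝔼 2))) ↔ ‖q.1‖ < 1 ∧ ‖q.2‖ < 2 := by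
  simp [dom, mem_prod, dist_zero_right]

/-- The tube neighbourhood `N = G(D̊² × B(0,2))` of the open disc [folklore] -/
def N : Set (𝔼 4) := D.G '' dom

/-- `G` is smooth at every point of its domain. [folklore] -/
theorem contDiffAt_G {q : (𝔼 2) × (𝔼 2)} (hq : q ∈ (dom : Set ((𝔼 2) × (𝔼 2)))) : ContDiffAt ℝ ∞ D.G q :=
  D.contDiffOn.contDiffAt (isOpen_dom.mem_nhds hq)

/-- The derivative of `G` at a point of the domain as a linear equivalence (injective, equal dimensions) [folklore] -/
def derivEquiv {q : (𝔼 2) × (𝔼 2)} (hq : q ∈ (dom : Set ((𝔼 2) × (𝔼 2)))) : ((𝔼 2) × (𝔼 2)) ≃L[ℝ] (𝔼 4) :=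
  (LinearEquiv.ofBijective (fderiv ℝ D.G q).toLinearMap
    ⟨D.injective_fderiv q hq, (LinearMap.injective_iff_surjective_of_finrank_eq_finrank (by simp)).1
      (D.injective_fderiv q hq)⟩).toContinuousLinearEquiv

/-- The derivative equivalence is the derivative as a map. [folklore] -/
theorem coe_derivEquiv {q : (𝔼 2) × (𝔼 2)} (hq : q ∈ (dom : Set ((𝔼 2) × (𝔼 2)))) :
    ((D.derivEquiv hq : ((𝔼 2) × (𝔼 2)) ≃L[ℝ] (𝔼 4)) : ((𝔼 2) × (𝔼 2)) →L[ℝ] (𝔼 4)) = fderiv ℝ D.G q :=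
  ContinuousLinearMap.ext fun _ ↦ rfl

/-- `G` has an invertible strict derivative at every point of its domain. [folklore] -/
theorem hasStrictFDerivAt_G {q : (𝔼 2) × (𝔼 2)} (hq : q ∈ (dom : Set ((𝔼 2) × (𝔼 2)))) :
    HasStrictFDerivAt D.G ((D.derivEquiv hq : ((𝔼 2) × (𝔼 2)) ≃L[ℝ] (𝔼 4)) : ((𝔼 2) × (𝔼 2)) →L[ℝ] (𝔼 4)) q := by
  rw [coe_derivEquiv]
  exact (D.contDiffAt_G hq).hasStrictFDerivAt (by simp)

/-- **the tube neighbourhood is open** (inverse function theorem) [folklore] -/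
theorem isOpen_N : IsOpen D.N := by
  rw [isOpen_iff_mem_nhds]
  rintro _ ⟨q, hq, rfl⟩
  rw [← (D.hasStrictFDerivAt_G hq).map_nhds_eq_of_equiv]
  exact Filter.image_mem_map (isOpen_dom.mem_nhds hq)

/-- More generally `G` maps open subsets of the domain to open sets [folklore] -/
theorem isOpen_image {U : Set ((𝔼 2) × (𝔼 2))} (hU : IsOpen U) (hUd : U ⊆ dom) : IsOpen (D.G '' U) := by
  rw [isOpen_iff_mem_nhds]
  rintro _ ⟨q, hq, rfl⟩
  rw [← (D.hasStrictFDerivAt_G (hUd hq)).map_nhds_eq_of_equiv]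
  exact Filter.image_mem_map (hU.mem_nhds hq)

/-- The inverse of the disc tube on `N` [folklore] -/
def Ginv : 𝔼 4 → (𝔼 2) × (𝔼 2) := Function.invFunOn D.G dom

/-- `Ginv (G q) = q` on the domain. [folklore] -/
theorem Ginv_apply {q : (𝔼 2) × (𝔼 2)} (hq : q ∈ (dom : Set ((𝔼 2) × (𝔼 2)))) : D.Ginv (D.G q) = q :=
  D.injOn.leftInvOn_invFunOn hq

/-- `Ginv` maps the tube neighbourhood into the domain. [folklore] -/
theorem Ginv_mem {z : 𝔼 4} (hz : z ∈ D.N) : D.Ginv z ∈ (dom : Set ((𝔼 2) × (𝔼 2))) :=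
  Function.invFunOn_mem (by simpa [N] using hz)

/-- `G (Ginv z) = z` on the tube neighbourhood. [folklore] -/
theorem G_Ginv {z : 𝔼 4} (hz : z ∈ D.N) : D.G (D.Ginv z) = z :=
  Function.invFunOn_eq (by simpa [N] using hz)

/-- **the inverse of the disc tube is smooth on `N`** [folklore] -/
theorem contDiffAt_Ginv {z : 𝔼 4} (hz : z ∈ D.N) : ContDiffAt ℝ ∞ D.Ginv z := by
  set q := D.Ginv z with hqdef
  have hq : q ∈ (dom : Set ((𝔼 2) × (𝔼 2))) := D.Ginv_mem hz
  have hGq : D.G q = z := D.G_Ginv hz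
  have hcd : ContDiffAt ℝ ∞ D.G q := D.contDiffAt_G hq
  have hder : HasFDerivAt D.G ((D.derivEquiv hq : ((𝔼 2) × (𝔼 2)) ≃L[ℝ] (𝔼 4)) : ((𝔼 2) × (𝔼 2)) →L[ℝ] (𝔼 4)) q :=
    (D.hasStrictFDerivAt_G hq).hasFDerivAt
  have hn : (∞ : ℕ∞ω) ≠ 0 := by simp
  have hstrict := hcd.hasStrictFDerivAt' hder hn
  have hleft : ∀ᶠ x in 𝓝 q, D.Ginv (D.G x) = x := by
    filter_upwards [isOpen_dom.mem_nhds hq] with x hx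
    exact D.Ginv_apply hx
  have huniq := HasStrictFDerivAt.localInverse_unique hstrict hleft
  have hloc : ContDiffAt ℝ ∞ (hcd.localInverse hder hn) (D.G q) := hcd.to_localInverse hder hn
  rw [hGq] at huniq hloc
  exact hloc.congr_of_eventuallyEq huniq

/-- `Ginv` is `C^∞` on the tube neighbourhood. [folklore] -/
theorem contDiffOn_Ginv : ContDiffOn ℝ ∞ D.Ginv D.N := fun _ hz ↦ (D.contDiffAt_Ginv hz).contDiffWithinAt

/-! ### The tube of the knot, the unit tube, the compact core -/

/-- The tube of `K` in `S³` as a `TubeNbhd` (tube coordinates and the surgery relation) [folklore] -/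
abbrev tube : TubeNbhd (𝓡 3) K := D.ν.toTubeNbhd

/-- The tube as a function is `ν`. [folklore] -/
theorem tube_apply (q : (𝕊 1) × (𝔼 2)) : D.tube.toFun q = D.ν q := rfl

/-- The closed unit tube `ν(𝕊¹ × B̄(0,1))`: directions for which the tube formulas are used [folklore] -/
def unitTube : Set (𝕊 3) := D.tube.toFun '' ((univ : Set (𝕊 1)) ×ˢ closedBall (0 : 𝔼 2) 1)

/-- `ν (u, w)` lies in the closed unit tube iff `‖w‖ ≤ 1`. [folklore] -/
theorem mem_unitTube_iff {u : 𝕊 1} {w : 𝔼 2} : D.tube.toFun (u, w) ∈ D.unitTube ↔ ‖w‖ ≤ 1 := by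
  rw [unitTube, D.tube.injective.mem_set_image]
  simp

/-- The knot lies in the closed unit tube. [folklore] -/
theorem range_subset_unitTube : range (K : 𝕊 1 → 𝕊 3) ⊆ D.unitTube := by
  rintro _ ⟨u, rfl⟩
  rw [← D.tube.apply_zero, mem_unitTube_iff]; simp

/-- The closed unit tube is compact. [folklore] -/
theorem isCompact_unitTube : IsCompact D.unitTube :=
  (isCompact_univ.prod (isCompact_closedBall _ _)).image D.tube.continuous

/-- The closed unit tube is closed. [folklore] -/
theorem isClosed_unitTube : IsClosed D.unitTube := D.isCompact_unitTube.isClosed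

/-- **the compact core** `K₀ = B̄(0, 1 - s₀) ∖ G(D̊² × B(0,1))` [folklore] -/
def core : Set (𝔼 4) := closedBall (0 : 𝔼 4) (1 - D.s₀) \ D.G '' (ball (0 : 𝔼 2) 1 ×ˢ ball (0 : 𝔼 2) 1)

/-- The core is compact. [folklore] -/
theorem isCompact_core : IsCompact D.core :=
  (isCompact_closedBall _ _).diff (D.isOpen_image (isOpen_ball.prod isOpen_ball)
    (prod_mono Subset.rfl (ball_subset_ball (by norm_num))))

/-- The core is closed. [folklore] -/
theorem isClosed_core : IsClosed D.core := D.isCompact_core.isClosed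

/-- The image `Δ = g(𝔻²)` of the closed disc (a compact set; `Δ ∩ B̊⁴ = G(D̊² × {0})`, `Δ ∩ 𝕊³ = K(𝕊¹)`) [folklore] -/
def disc : Set (𝔼 4) := D.g '' closedBall (0 : 𝔼 2) 1

/-- The disc is compact. [folklore] -/
theorem isCompact_disc : IsCompact D.disc :=
  (isCompact_closedBall _ _).image_of_continuousOn D.isSliceDisc.1.continuous.continuousOn

/-- The disc is closed. [folklore] -/
theorem isClosed_disc : IsClosed D.disc := D.isCompact_disc.isClosed

/-- The boundary circle goes to the knot, of norm `1` [folklore] -/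
theorem norm_g_of_norm_eq_one {x : 𝔼 2} (hx : ‖x‖ = 1) : ‖D.g x‖ = 1 := by
  have hx0 : x ≠ 0 := by rintro rfl; simp at hx
  have := D.g_cone (radialProjection (spherePt 1) x) 1 (by linarith [D.s₁_pos]) le_rfl
  rw [one_smul, one_smul] at this
  rw [← norm_smul_coe_radialProjection (spherePt 1) x, hx, one_smul, this, norm_eq_of_mem_sphere]

/-- The zero section of the tube is the disc. [folklore] -/
theorem G_zero_mem_disc {x : 𝔼 2} (hx : ‖x‖ < 1) : D.G (x, 0) ∈ D.disc :=
  ⟨x, by simpa using hx.le, (D.apply_zero x (by simpa using hx)).symm⟩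

/-- A tube point off the zero section is off the disc [folklore] -/
theorem G_not_mem_disc {x w : 𝔼 2} (hx : ‖x‖ < 1) (hw : ‖w‖ < 2) (hw0 : w ≠ 0) : D.G (x, w) ∉ D.disc := by
  intro hmem
  obtain ⟨x', hx', h⟩ : ∃ x' ∈ closedBall (0 : 𝔼 2) 1, D.g x' = D.G (x, w) := hmem
  have hx'' : ‖x'‖ ≤ 1 := by rwa [mem_closedBall, dist_zero_right] at hx'
  have hq2 : ((x, w) : (𝔼 2) × (𝔼 2)) ∈ (dom : Set ((𝔼 2) × (𝔼 2))) := mem_dom_iff.2 ⟨hx, hw⟩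
  rcases hx''.lt_or_eq with hlt | heq
  · have h2 : D.G (x', 0) = D.G (x, w) := by rw [D.apply_zero x' (by simpa using hlt)]; exact h
    have hq1 : ((x', (0 : 𝔼 2)) : (𝔼 2) × (𝔼 2)) ∈ (dom : Set ((𝔼 2) × (𝔼 2))) :=
      mem_dom_iff.2 ⟨hlt, by simp⟩
    have := D.injOn hq1 hq2 h2
    exact hw0 (congrArg Prod.snd this).symm
  · -- a boundary point of the disc has norm `1`, a tube point norm `< 1`
    have h1 : ‖D.G (x, w)‖ = 1 := by rw [← h]; exact D.norm_g_of_norm_eq_one heq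
    have h2 := D.maps_ball _ hq2
    rw [mem_ball, dist_zero_right, h1] at h2
    exact lt_irrefl _ h2

/-! ### The collar and its inverse: definitions -/

section Defs

variable {Y : Type*}

/-- **radial formula** `(a, σ) ↦ (1 - Einv s₀ (e^{-σ})) • a` (depth `ℓ` with `E_{s₀}(ℓ) = e^{-σ}`) [folklore] -/
def cRad (a : 𝕊 3) (σ : ℝ) : 𝔼 4 := (1 - SliceCollar.Einv D.s₀ (Real.exp (-σ))) • (a : 𝔼 4)

/-- The profile coordinates `(ℓ, r) = Ψ⁻¹ (‖w‖, σ)` over the tube point `ν (u, w)` [folklore] -/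
def baseP (a : 𝕊 3) (σ : ℝ) : ℝ × ℝ := SliceCollar.Ψinv D.s₀ (‖(D.tube.toHomeo.symm a).2‖, σ)

/-- The tube point of the ball with profile coordinates `(ℓ, r)` and angles `(u, v)`: `G ((1 - ℓ) u, r v)` [folklore] -/
def ptB (ℓ r : ℝ) (u v : 𝕊 1) : 𝔼 4 := D.G ((1 - ℓ) • (u : 𝔼 2), r • (v : 𝔼 2))

/-- **tube formula** `(ν(u, w), σ) ↦ G ((1 - ℓ) u, r ŵ)`, `(ℓ, r) = Ψ⁻¹ (‖w‖, σ)` [folklore] -/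
def cTube (a : 𝕊 3) (σ : ℝ) : 𝔼 4 :=
  D.ptB (D.baseP a σ).1 (D.baseP a σ).2 (D.tube.toHomeo.symm a).1 (radialProjection (spherePt 1) (D.tube.toHomeo.symm a).2)

/-- **flat formula** near the dual knot: `((p, v), σ) ↦ G (4 p, Einv 1 (e^{-σ}) • v)` [folklore] -/
def cFlat (b : (𝔼 2) × (𝕊 1)) (σ : ℝ) : 𝔼 4 :=
  D.G ((4 : ℝ) • b.1, SliceCollar.Einv 1 (Real.exp (-σ)) • (b.2 : 𝔼 2))

/-- The radial part of `Y`: directions outside the closed unit tube [folklore] -/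
def radSet (jA : D.tube.complement → Y) : Set Y := jA '' {a | (a : 𝕊 3) ∉ D.unitTube}

open Classical in
/-- **the collar** `Y × ℝ → ℝ⁴` [folklore] -/
def collar (jA : D.tube.complement → Y) (jB : ↥solidTorus → Y) (p : Y × ℝ) : 𝔼 4 :=
  if p.1 ∈ D.radSet jA then D.cRad (D.tube.invA jA p.1) p.2
  else if p.1 ∈ range jA then D.cTube (D.tube.invA jA p.1) p.2
  else D.cFlat (TubeNbhd.invB jB p.1) p.2

/-- **radial inverse formula** `z ↦ (jA ẑ, -log E_{s₀}(1 - ‖z‖))` [folklore] -/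
def ΨRad (jA : D.tube.complement → Y) (z : 𝔼 4) : Y × ℝ :=
  (D.tube.jAt jA (radialProjection (spherePt 3) z), -Real.log (SliceCollar.E D.s₀ (1 - ‖z‖)))

/-- The profile values `(τ, h) = Ψ (1 - ‖x‖, ‖w‖)` at the tube point `G (x, w)` [folklore] -/
def profB (z : 𝔼 4) : ℝ × ℝ := SliceCollar.Ψ D.s₀ (1 - ‖(D.Ginv z).1‖, ‖(D.Ginv z).2‖)

/-- **tube inverse formula** `G(x, w) ↦ (jA (ν (x̂, τ ŵ)), h)` [folklore] -/
def ΨTube (jA : D.tube.complement → Y) (z : 𝔼 4) : Y × ℝ :=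
  (D.tube.ptY jA (D.profB z).1 (radialProjection (spherePt 1) (D.Ginv z).1)
    (radialProjection (spherePt 1) (D.Ginv z).2), (D.profB z).2)

/-- **flat inverse formula** `G(x, w) ↦ (jB (x/4, ŵ), -log E_1(‖w‖))` [folklore] -/
def ΨFlat (jB : ↥solidTorus → Y) (z : 𝔼 4) : Y × ℝ :=
  (TubeNbhd.jBt jB ((4 : ℝ)⁻¹ • (D.Ginv z).1, radialProjection (spherePt 1) (D.Ginv z).2),
    -Real.log (SliceCollar.E 1 ‖(D.Ginv z).2‖))

/-- The radial region of the ball: norm `> 1 - s₀`, direction outside the closed unit tube [folklore] -/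
def radSetT : Set (𝔼 4) := {z | 1 - D.s₀ < ‖z‖ ∧ radialProjection (spherePt 3) z ∉ D.unitTube}

open Classical in
/-- **the inverse collar** `ℝ⁴ → Y × ℝ` (meaningful on the collar region) [folklore] -/
def collarInv (jA : D.tube.complement → Y) (jB : ↥solidTorus → Y) (z : 𝔼 4) : Y × ℝ :=
  if z ∈ D.radSetT then D.ΨRad jA z
  else if (D.Ginv z).1 ≠ 0 then D.ΨTube jA z
  else D.ΨFlat jB z

end Defs

/-! ### Elementary computations -/

section Computations

/-- The cone formula at a nonzero disc coordinate in the conical band [folklore] -/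
theorem G_eq_smul {x : 𝔼 2} (hx1 : 1 - D.s₁ < ‖x‖) (hx2 : ‖x‖ < 1) {w : 𝔼 2} (hw : ‖w‖ < 2) :
    D.G (x, w) = ‖x‖ • ((D.tube.toFun (radialProjection (spherePt 1) x, w) : 𝕊 3) : 𝔼 4) := by
  conv_lhs => rw [← norm_smul_coe_radialProjection (spherePt 1) x]
  exact D.cone _ _ _ hx1 hx2 hw

/-- The tube point in the conical band: `G ((1-ℓ) u, r v) = (1-ℓ) • ν (u, r v)` for `0 < ℓ < s₁` [folklore] -/
theorem ptB_of_lt {ℓ r : ℝ} (hℓ0 : 0 < ℓ) (hℓ : ℓ < D.s₁) (hr : |r| < 2) (u v : 𝕊 1) :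
    D.ptB ℓ r u v = (1 - ℓ) • ((D.tube.toFun (u, r • (v : 𝔼 2)) : 𝕊 3) : 𝔼 4) := by
  rw [ptB]
  exact D.cone u (1 - ℓ) _ (by linarith) (by linarith) (by rwa [norm_smul, norm_eq_of_mem_sphere, mul_one, Real.norm_eq_abs])

/-- `‖t • a‖ = t` for `t ≥ 0` and `a ∈ S³`. [folklore] -/
theorem norm_smul_coe {t : ℝ} (ht : 0 ≤ t) (a : 𝕊 3) : ‖t • (a : 𝔼 4)‖ = t := norm_smul_coe_sphere ht a

/-- The tube point is deep for `ℓ ≥ s₀` [folklore] -/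
theorem norm_ptB_le {ℓ r : ℝ} (hℓ : D.s₀ ≤ ℓ) (hℓ1 : ℓ ≤ 1) (hr : |r| < 2) (u v : 𝕊 1) : ‖D.ptB ℓ r u v‖ ≤ 1 - D.s₀ := by
  rw [ptB]
  refine D.deep _ _ ?_ ?_
  · rw [norm_smul_coe_sphere (by linarith)]; linarith
  · rwa [norm_smul, norm_eq_of_mem_sphere, mul_one, Real.norm_eq_abs]

/-- The arguments of `ptB` lie in the domain for `0 < ℓ`, `ℓ < 1`... precisely `0 < 1 - ℓ < 1`, `|r| < 2` [folklore] -/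
theorem ptB_arg_mem_dom {ℓ r : ℝ} (hℓ0 : 0 < ℓ) (hℓ1 : ℓ < 1) (hr : |r| < 2) (u v : 𝕊 1) :
    (((1 - ℓ) • (u : 𝔼 2), r • (v : 𝔼 2)) : (𝔼 2) × (𝔼 2)) ∈ (dom : Set ((𝔼 2) × (𝔼 2))) := by
  refine mem_dom_iff.2 ⟨?_, ?_⟩
  · simp only; rw [norm_smul_coe_sphere (by linarith)]; linarith
  · simp only; rwa [norm_smul, norm_eq_of_mem_sphere, mul_one, Real.norm_eq_abs]

/-- The handle coordinates of the tube point `ptB`. [folklore] -/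
theorem Ginv_ptB {ℓ r : ℝ} (hℓ0 : 0 < ℓ) (hℓ1 : ℓ < 1) (hr : |r| < 2) (u v : 𝕊 1) :
    D.Ginv (D.ptB ℓ r u v) = ((1 - ℓ) • (u : 𝔼 2), r • (v : 𝔼 2)) :=
  D.Ginv_apply (ptB_arg_mem_dom hℓ0 hℓ1 hr u v)

/-- The tube point `ptB` lies in the tube neighbourhood. [folklore] -/
theorem ptB_mem_N {ℓ r : ℝ} (hℓ0 : 0 < ℓ) (hℓ1 : ℓ < 1) (hr : |r| < 2) (u v : 𝕊 1) : D.ptB ℓ r u v ∈ D.N :=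
  ⟨_, ptB_arg_mem_dom hℓ0 hℓ1 hr u v, rfl⟩

/-- The base coordinates over the tube point `ν (u, w)` [folklore] -/
theorem baseP_apply (u : 𝕊 1) (w : 𝔼 2) (σ : ℝ) : D.baseP (D.tube.toFun (u, w)) σ = SliceCollar.Ψinv D.s₀ (‖w‖, σ) := by
  rw [baseP, TubeNbhd.toHomeo_symm_apply']

/-- `(‖w‖, σ)` lies in the strip for `0 < ‖w‖ < 2`. [folklore] -/
theorem mem_Strip {w : 𝔼 2} (hw : w ≠ 0) (hw2 : ‖w‖ < 2) (σ : ℝ) : (‖w‖, σ) ∈ SliceCollar.Strip :=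
  ⟨⟨norm_pos_iff.2 hw, hw2⟩, mem_univ _⟩

/-- The base coordinates over a tube point lie in the L-shaped domain. [folklore] -/
theorem baseP_mem {u : 𝕊 1} {w : 𝔼 2} (hw : w ≠ 0) (hw2 : ‖w‖ < 2) (σ : ℝ) :
    D.baseP (D.tube.toFun (u, w)) σ ∈ SliceCollar.P D.s₀ := by
  rw [baseP_apply]; exact SliceCollar.Ψinv_mem D.s₀_pos D.s₀_lt_one (mem_Strip hw hw2 σ)

/-- `Ψ (Ψ⁻¹ (‖w‖, σ)) = (‖w‖, σ)` over a tube point. [folklore] -/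
theorem Ψ_baseP {u : 𝕊 1} {w : 𝔼 2} (hw : w ≠ 0) (hw2 : ‖w‖ < 2) (σ : ℝ) :
    SliceCollar.Ψ D.s₀ (D.baseP (D.tube.toFun (u, w)) σ) = (‖w‖, σ) := by
  rw [baseP_apply]; exact SliceCollar.Ψ_Ψinv D.s₀_pos D.s₀_lt_one (mem_Strip hw hw2 σ)

/-- The tube formula at `ν (u, w)` in terms of the base coordinates. [folklore] -/
theorem cTube_apply (u : 𝕊 1) (w : 𝔼 2) (σ : ℝ) :
    D.cTube (D.tube.toFun (u, w)) σ = D.ptB (D.baseP (D.tube.toFun (u, w)) σ).1 (D.baseP (D.tube.toFun (u, w)) σ).2 u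
      (radialProjection (spherePt 1) w) := by
  rw [cTube, TubeNbhd.toHomeo_symm_apply']

/-- Unpacking membership in `P s₀` [folklore] -/
theorem bounds_of_mem_P {p : ℝ × ℝ} (hp : p ∈ SliceCollar.P D.s₀) :
    0 < p.1 ∧ p.1 < 1 ∧ 0 < p.2 ∧ p.2 < 2 ∧ (p.1 < D.s₀ ∨ p.2 < 1) := SliceCollar.mem_P_iff.1 hp

/-- In `P s₀`, the image `τ ≤ 1` forces `r ≤ 1` [folklore] -/
theorem snd_le_one_of_τ_le_one {p : ℝ × ℝ} (hp : p ∈ SliceCollar.P D.s₀) (h : (SliceCollar.Ψ D.s₀ p).1 ≤ 1) : p.2 ≤ 1 := by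
  obtain ⟨-, -, h2, -, -⟩ := D.bounds_of_mem_P hp
  by_contra hr
  rw [not_le] at hr
  have := SliceCollar.one_le_τ_of_one_le D.s₀ h2 hr.le
  have hτ : (SliceCollar.Ψ D.s₀ p).1 = SliceCollar.R p.2 := by
    rw [SliceCollar.Ψ_of_one_le D.s₀ h2 hr.le]
  have hR : 1 < SliceCollar.R p.2 := by
    rw [← SliceCollar.R_of_one_le le_rfl]; exact SliceCollar.strictMono_R hr
  have hτ' : (SliceCollar.Ψ D.s₀ p).1 = SliceCollar.τ D.s₀ p := rfl
  linarith

/-- In `P s₀`, the image `τ > 1` forces `r ≥ 1`, hence the right regime: `r = τ`, `ℓ < s₀`, `e^{-h} = E_{s₀} ℓ` [folklore] -/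
theorem right_of_one_lt_τ {p : ℝ × ℝ} (hp : p ∈ SliceCollar.P D.s₀) (h : 1 < (SliceCollar.Ψ D.s₀ p).1) :
    1 ≤ p.2 ∧ p.1 < D.s₀ ∧ SliceCollar.Ψ D.s₀ p = (p.2, -Real.log (SliceCollar.E D.s₀ p.1)) := by
  obtain ⟨h0, -, h2, -, hor⟩ := D.bounds_of_mem_P hp
  have hr : 1 ≤ p.2 := by
    by_contra hr
    rw [not_le] at hr
    rcases lt_or_ge p.1 D.s₀ with hℓ | hℓ
    · linarith [(SliceCollar.τ_mem_of_corner h0 hℓ h2 hr).2, show (SliceCollar.Ψ D.s₀ p).1 = SliceCollar.τ D.s₀ p from rfl]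
    · have := SliceCollar.τ_le_of_le D.s₀_pos h0 hℓ h2 hr
      have hT : SliceCollar.T D.s₀ < 1 := by rw [SliceCollar.T]; linarith [D.s₀_pos]
      linarith [show (SliceCollar.Ψ D.s₀ p).1 = SliceCollar.τ D.s₀ p from rfl]
  refine ⟨hr, hor.resolve_right (not_lt.2 hr), ?_⟩
  rw [SliceCollar.Ψ_of_one_le D.s₀ h2 hr, SliceCollar.R_of_one_le hr]

end Computations

/-! ### Branch evaluation -/

section Branches

variable {Y : Type*} [TopologicalSpace Y] [ChartedSpace (𝔼 3) Y]
  {jA : D.tube.complement → Y} {jB : ↥solidTorus → Y}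

/-- `jA a ∈ radSet` iff `a` is outside the closed unit tube. [folklore] -/
theorem jA_mem_radSet_iff (hG : D.tube.IsSurgeryWith jA jB) (a : D.tube.complement) :
    jA a ∈ D.radSet jA ↔ (a : 𝕊 3) ∉ D.unitTube :=
  (D.tube.injective_jA hG).mem_set_image

omit [TopologicalSpace Y] [ChartedSpace (𝔼 3) Y] in
/-- `radSet ⊆ range jA`. [folklore] -/
theorem radSet_subset_range (jA : D.tube.complement → Y) : D.radSet jA ⊆ range jA := image_subset_range _ _

/-- **branch R** [folklore] -/
theorem collar_of_not_mem_unitTube (hG : D.tube.IsSurgeryWith jA jB) (a : D.tube.complement) (ha : (a : 𝕊 3) ∉ D.unitTube)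
    (σ : ℝ) : D.collar jA jB (jA a, σ) = D.cRad a σ := by
  rw [collar, if_pos ((D.jA_mem_radSet_iff hG a).2 ha), D.tube.invA_apply hG]

/-- **branch P** [folklore] -/
theorem collar_of_mem_unitTube (hG : D.tube.IsSurgeryWith jA jB) (a : D.tube.complement) (ha : (a : 𝕊 3) ∈ D.unitTube)
    (σ : ℝ) : D.collar jA jB (jA a, σ) = D.cTube a σ := by
  rw [collar, if_neg (fun h ↦ (D.jA_mem_radSet_iff hG a).1 h ha), if_pos (mem_range_self a), D.tube.invA_apply hG]

/-- **branch F** [folklore] -/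
theorem collar_of_core (hG : D.tube.IsSurgeryWith jA jB) (v : 𝕊 1) (h : ((0 : 𝔼 2), v) ∈ solidTorus) (σ : ℝ) :
    D.collar jA jB (jB ⟨((0 : 𝔼 2), v), h⟩, σ) = D.cFlat ((0 : 𝔼 2), v) σ := by
  have h1 := D.tube.jB_zero_not_mem_range hG v h
  rw [collar, if_neg (fun h' ↦ h1 (D.radSet_subset_range jA h')), if_neg h1, TubeNbhd.invB_apply _ hG]

omit [TopologicalSpace Y] [ChartedSpace (𝔼 3) Y] in
/-- **branch R'** [folklore] -/
theorem collarInv_of_mem_radSetT {z : 𝔼 4} (hz : z ∈ D.radSetT) : D.collarInv jA jB z = D.ΨRad jA z := by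
  rw [collarInv, if_pos hz]

omit [TopologicalSpace Y] [ChartedSpace (𝔼 3) Y] in
/-- **branch P'** [folklore] -/
theorem collarInv_of_fst_ne_zero {z : 𝔼 4} (hz : z ∉ D.radSetT) (hx : (D.Ginv z).1 ≠ 0) :
    D.collarInv jA jB z = D.ΨTube jA z := by
  rw [collarInv, if_neg hz, if_pos hx]

omit [TopologicalSpace Y] [ChartedSpace (𝔼 3) Y] in
/-- **branch F'** [folklore] -/
theorem collarInv_of_fst_eq_zero {z : 𝔼 4} (hz : z ∉ D.radSetT) (hx : (D.Ginv z).1 = 0) :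
    D.collarInv jA jB z = D.ΨFlat jB z := by
  rw [collarInv, if_neg hz, if_neg (not_not.2 hx)]

/-- A deep point is not in the radial region [folklore] -/
theorem not_mem_radSetT_of_norm_le {z : 𝔼 4} (hz : ‖z‖ ≤ 1 - D.s₀) : z ∉ D.radSetT := fun h ↦ (not_lt.2 hz) h.1

end Branches

/-! ### `collarInv ∘ collar = id` -/

section LeftInverse

variable {Y : Type*} [TopologicalSpace Y] [ChartedSpace (𝔼 3) Y]
  {jA : D.tube.complement → Y} {jB : ↥solidTorus → Y}

/-- **branch R**: `collarInv (collar (jA a, σ)) = (jA a, σ)` outside the closed unit tube [folklore] -/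
theorem collarInv_collar_rad (hG : D.tube.IsSurgeryWith jA jB) (a : D.tube.complement) (ha : (a : 𝕊 3) ∉ D.unitTube)
    (σ : ℝ) : D.collarInv jA jB (D.collar jA jB (jA a, σ)) = (jA a, σ) := by
  have hℓ := SliceCollar.Einv_mem D.s₀_pos (Real.exp (-σ))
  rw [D.collar_of_not_mem_unitTube hG a ha, cRad]
  have hnorm : ‖(1 - SliceCollar.Einv D.s₀ (Real.exp (-σ))) • ((a : 𝕊 3) : 𝔼 4)‖ =
      1 - SliceCollar.Einv D.s₀ (Real.exp (-σ)) := norm_smul_coe_sphere (by linarith [hℓ.2, D.s₀_lt_one]) _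
  have hdir : radialProjection (spherePt 3) ((1 - SliceCollar.Einv D.s₀ (Real.exp (-σ))) • ((a : 𝕊 3) : 𝔼 4)) = a :=
    radialProjection_smul _ (by linarith [hℓ.2, D.s₀_lt_one]) _
  have hmem : (1 - SliceCollar.Einv D.s₀ (Real.exp (-σ))) • ((a : 𝕊 3) : 𝔼 4) ∈ D.radSetT := by
    refine ⟨?_, ?_⟩
    · rw [hnorm]; linarith [hℓ.2]
    · rw [hdir]; exact ha
  rw [D.collarInv_of_mem_radSetT hmem, ΨRad, hdir, hnorm, sub_sub_cancel, SliceCollar.E_Einv _ (Real.exp_pos _),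
    Real.log_exp, neg_neg, D.tube.jAt_of_mem jA a.2]

/-- **branch P**: `collarInv (collar (jA a, σ)) = (jA a, σ)` over the closed unit tube [folklore] -/
theorem collarInv_collar_tube (hG : D.tube.IsSurgeryWith jA jB) (a : D.tube.complement) (ha : (a : 𝕊 3) ∈ D.unitTube)
    (σ : ℝ) : D.collarInv jA jB (D.collar jA jB (jA a, σ)) = (jA a, σ) := by
  -- write `a = ν (u, w)` with `0 < ‖w‖ ≤ 1`
  obtain ⟨⟨u, w⟩, ⟨-, hw1⟩, hqa⟩ := ha
  rw [mem_closedBall, dist_zero_right] at hw1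
  have hw : w ≠ 0 := fun h ↦ a.2 (by rw [← hqa, h, D.tube.apply_zero]; exact mem_range_self u)
  have hwpos : 0 < ‖w‖ := norm_pos_iff.2 hw
  have hw2 : ‖w‖ < 2 := by linarith
  have haeq : (a : 𝕊 3) = D.tube.toFun (u, w) := hqa.symm
  set p := D.baseP (D.tube.toFun (u, w)) σ with hp
  have hP : p ∈ SliceCollar.P D.s₀ := D.baseP_mem hw hw2 σ
  obtain ⟨hℓ0, hℓ1, hr0, hr2, hor⟩ := D.bounds_of_mem_P hP
  have hΨ : SliceCollar.Ψ D.s₀ p = (‖w‖, σ) := D.Ψ_baseP hw hw2 σ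
  have hr2' : |p.2| < 2 := by rw [abs_of_pos hr0]; exact hr2
  have hr1 : p.2 ≤ 1 := D.snd_le_one_of_τ_le_one hP (by rw [hΨ]; exact hw1)
  rw [D.collar_of_mem_unitTube hG a ⟨(u, w), ⟨mem_univ _, by simpa using hw1⟩, hqa⟩, haeq, cTube_apply]
  -- the collar point is not in the radial region
  have hnot : D.ptB p.1 p.2 u (radialProjection (spherePt 1) w) ∉ D.radSetT := by
    rcases lt_or_ge p.1 D.s₀ with hℓ | hℓ
    · rintro ⟨-, hdir⟩
      rw [D.ptB_of_lt hℓ0 (hℓ.trans D.s₀_lt) hr2', radialProjection_smul _ (by linarith), mem_unitTube_iff,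
        norm_smul_coe_sphere hr0.le] at hdir
      exact hdir hr1
    · exact D.not_mem_radSetT_of_norm_le (D.norm_ptB_le hℓ hℓ1.le hr2' _ _)
  have hGinv := D.Ginv_ptB hℓ0 hℓ1 hr2' u (radialProjection (spherePt 1) w)
  have hx0 : (D.Ginv (D.ptB p.1 p.2 u (radialProjection (spherePt 1) w))).1 ≠ 0 := by
    rw [hGinv]; exact smul_ne_zero (by linarith) (ne_zero_of_mem_unit_sphere u)
  rw [D.collarInv_of_fst_ne_zero hnot hx0, ΨTube, profB, hGinv]
  simp only
  rw [norm_smul_coe_sphere (by linarith), norm_smul_coe_sphere hr0.le, sub_sub_cancel, show (p.1, p.2) = p from rfl, hΨ,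
    radialProjection_smul _ (by linarith : (0 : ℝ) < 1 - p.1), radialProjection_smul _ hr0]
  refine Prod.ext ?_ rfl
  show D.tube.ptY jA ‖w‖ u (radialProjection (spherePt 1) w) = jA a
  rw [D.tube.ptY_eq jA hwpos.ne']
  congr 1; ext1
  rw [haeq]; simp only [norm_smul_coe_radialProjection]

/-- **branch F**: `collarInv (collar (y, σ)) = (y, σ)` on the core circle of the surgery torus [folklore] -/
theorem collarInv_collar_core (hG : D.tube.IsSurgeryWith jA jB) (v : 𝕊 1) (h : ((0 : 𝔼 2), v) ∈ solidTorus)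
    (σ : ℝ) : D.collarInv jA jB (D.collar jA jB (jB ⟨((0 : 𝔼 2), v), h⟩, σ)) = (jB ⟨((0 : 𝔼 2), v), h⟩, σ) := by
  have hr := SliceCollar.Einv_mem one_pos (Real.exp (-σ))
  rw [D.collar_of_core hG v h, cFlat]
  simp only [smul_zero]
  have hdom : (((0 : 𝔼 2), SliceCollar.Einv 1 (Real.exp (-σ)) • (v : 𝔼 2)) : (𝔼 2) × (𝔼 2)) ∈ (dom : Set ((𝔼 2) × (𝔼 2))) := by
    refine mem_dom_iff.2 ⟨by simp, ?_⟩
    simp only; rw [norm_smul_coe_sphere hr.1.le]; linarith [hr.2]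
  have hnorm : ‖D.G ((0 : 𝔼 2), SliceCollar.Einv 1 (Real.exp (-σ)) • (v : 𝔼 2))‖ ≤ 1 - D.s₀ :=
    D.deep _ _ (by simp; linarith [D.s₀_lt_one]) (by rw [norm_smul_coe_sphere hr.1.le]; linarith [hr.2])
  have hGinv := D.Ginv_apply hdom
  rw [D.collarInv_of_fst_eq_zero (D.not_mem_radSetT_of_norm_le hnorm) (by rw [hGinv]), ΨFlat, hGinv]
  simp only [smul_zero]
  rw [radialProjection_smul _ hr.1, norm_smul_coe_sphere hr.1.le, SliceCollar.E_Einv _ (Real.exp_pos _), Real.log_exp,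
    neg_neg]
  refine Prod.ext ?_ rfl
  exact TubeNbhd.jBt_of_norm_lt jB (by simp)

/-- **`collarInv ∘ collar = id` on `Y × ℝ`** [folklore] -/
theorem collarInv_collar (hG : D.tube.IsSurgeryWith jA jB) (p : Y × ℝ) : D.collarInv jA jB (D.collar jA jB p) = p := by
  obtain ⟨y, σ⟩ := p
  by_cases hy : y ∈ range jA
  · obtain ⟨a, rfl⟩ := hy
    by_cases ha : (a : 𝕊 3) ∈ D.unitTube
    · exact D.collarInv_collar_tube hG a ha σ
    · exact D.collarInv_collar_rad hG a ha σ
  · obtain ⟨v, h, rfl⟩ := D.tube.eq_jB_zero_of_not_mem_range hG hy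
    exact D.collarInv_collar_core hG v h σ

end LeftInverse

/-! ### `collar ∘ collarInv = id` on the collar region -/

section RightInverse

variable {Y : Type*} [TopologicalSpace Y] [ChartedSpace (𝔼 3) Y]
  {jA : D.tube.complement → Y} {jB : ↥solidTorus → Y}

/-- **the collar region**: the open unit ball minus the disc and the compact core [folklore] -/
def region : Set (𝔼 4) := {z | ‖z‖ < 1 ∧ z ∉ D.disc ∧ z ∉ D.core}

/-- A tube point off the core over the deep disc has normal radius `< 1` [folklore] -/
theorem norm_snd_lt_one {q : (𝔼 2) × (𝔼 2)} (hq : q ∈ (dom : Set ((𝔼 2) × (𝔼 2)))) (hcore : D.G q ∉ D.core)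
    (hx : ‖q.1‖ ≤ 1 - D.s₀) : ‖q.2‖ < 1 := by
  have hnorm : ‖D.G q‖ ≤ 1 - D.s₀ := D.deep q.1 q.2 hx (mem_dom_iff.1 hq).2
  have hmem : D.G q ∈ D.G '' (ball (0 : 𝔼 2) 1 ×ˢ ball (0 : 𝔼 2) 1) := by
    by_contra h
    exact hcore ⟨by simpa using hnorm, h⟩
  obtain ⟨q', hq', heq⟩ := hmem
  rw [mem_prod, mem_ball, mem_ball, dist_zero_right, dist_zero_right] at hq'
  have := D.injOn (mem_dom_iff.2 ⟨hq'.1, hq'.2.trans one_lt_two⟩) hq heq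
  rw [← this]; exact hq'.2

/-- A tube point off the disc has nonzero normal coordinate [folklore] -/
theorem snd_ne_zero_of_not_mem_disc {q : (𝔼 2) × (𝔼 2)} (hq : q ∈ (dom : Set ((𝔼 2) × (𝔼 2)))) (hdisc : D.G q ∉ D.disc) :
    q.2 ≠ 0 := by
  intro h
  obtain ⟨x, w⟩ := q
  simp only at h; subst h
  exact hdisc (D.G_zero_mem_disc (mem_dom_iff.1 hq).1)

/-- **the profile coordinates of a point of the collar region in the tube lie in `P s₀`** [folklore] -/
theorem mem_P_of_region {q : (𝔼 2) × (𝔼 2)} (hq : q ∈ (dom : Set ((𝔼 2) × (𝔼 2)))) (hx : q.1 ≠ 0)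
    (hdisc : D.G q ∉ D.disc) (hcore : D.G q ∉ D.core) : (1 - ‖q.1‖, ‖q.2‖) ∈ SliceCollar.P D.s₀ := by
  obtain ⟨h1, h2⟩ := mem_dom_iff.1 hq
  have hw := D.snd_ne_zero_of_not_mem_disc hq hdisc
  refine SliceCollar.mem_P_iff.2 ⟨by simp only; linarith, by simp only; linarith [norm_pos_iff.2 hx], norm_pos_iff.2 hw, h2, ?_⟩
  simp only
  by_contra h
  rw [not_or, not_lt, not_lt] at h
  have := D.norm_snd_lt_one hq hcore (by linarith [h.1])
  linarith [h.2]

/-- **branch R'**: `collar (collarInv z) = z` on the radial region [folklore] -/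
theorem collar_collarInv_rad (hG : D.tube.IsSurgeryWith jA jB) {z : 𝔼 4} (hz : z ∈ D.radSetT) (hz1 : ‖z‖ < 1) :
    D.collar jA jB (D.collarInv jA jB z) = z := by
  obtain ⟨hzn, hdir⟩ := hz
  have hℓ0 : 0 < 1 - ‖z‖ := by linarith
  have hℓ : 1 - ‖z‖ < D.s₀ := by linarith
  have hrange : radialProjection (spherePt 3) z ∉ range (K : 𝕊 1 → 𝕊 3) := fun h ↦ hdir (D.range_subset_unitTube h)
  rw [D.collarInv_of_mem_radSetT ⟨hzn, hdir⟩, ΨRad, D.tube.jAt_of_mem jA hrange,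
    D.collar_of_not_mem_unitTube hG ⟨_, hrange⟩ hdir, cRad]
  simp only [neg_neg]
  rw [Real.exp_log (SliceCollar.E_pos D.s₀_pos hℓ0 hℓ), SliceCollar.Einv_E D.s₀_pos hℓ0 hℓ, sub_sub_cancel,
    norm_smul_coe_radialProjection]

/-- **branch P'**: `collar (collarInv z) = z` in the tube, off the centre fibre [folklore] -/
theorem collar_collarInv_tube (hG : D.tube.IsSurgeryWith jA jB) {z : 𝔼 4} (hz : z ∉ D.radSetT) (hN : z ∈ D.N)
    (hx : (D.Ginv z).1 ≠ 0) (hdisc : z ∉ D.disc) (hcore : z ∉ D.core) :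
    D.collar jA jB (D.collarInv jA jB z) = z := by
  have hq := D.Ginv_mem hN
  have hGz := D.G_Ginv hN
  set x := (D.Ginv z).1 with hxdef
  set w := (D.Ginv z).2 with hwdef
  have hqeq : D.Ginv z = (x, w) := rfl
  rw [hqeq] at hq hGz
  obtain ⟨hx1, hw2⟩ := mem_dom_iff.1 hq
  have hw : w ≠ 0 := D.snd_ne_zero_of_not_mem_disc hq (by rw [hGz]; exact hdisc)
  have hwpos : 0 < ‖w‖ := norm_pos_iff.2 hw
  have hxpos : 0 < ‖x‖ := norm_pos_iff.2 hx
  set p : ℝ × ℝ := (1 - ‖x‖, ‖w‖) with hpdef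
  have hP : p ∈ SliceCollar.P D.s₀ := D.mem_P_of_region hq hx (by rw [hGz]; exact hdisc) (by rw [hGz]; exact hcore)
  obtain ⟨hℓ0, hℓ1, hr0, hr2, hor⟩ := D.bounds_of_mem_P hP
  have hτ := (SliceCollar.Ψ_mem_Strip hP).1
  have hτ0 : 0 < (SliceCollar.Ψ D.s₀ p).1 := hτ.1
  -- evaluate the inverse collar
  rw [D.collarInv_of_fst_ne_zero hz hx, ΨTube, profB, ← hxdef, ← hwdef, ← hpdef]
  -- the new `Y`-point is `jA (ν (x̂, τ ŵ))`; which branch of the collar?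
  by_cases h1 : (SliceCollar.Ψ D.s₀ p).1 ≤ 1
  · -- tube branch: `τ ≤ 1`
    rw [D.tube.ptY_eq jA hτ0.ne']
    have hmem : D.tube.toFun (radialProjection (spherePt 1) x, (SliceCollar.Ψ D.s₀ p).1 • ((radialProjection (spherePt 1) w : 𝕊 1) : 𝔼 2)) ∈
        D.unitTube := by
      rw [mem_unitTube_iff, norm_smul_coe_sphere hτ0.le]; exact h1
    rw [D.collar_of_mem_unitTube hG _ hmem, cTube_apply, baseP_apply, norm_smul_coe_sphere hτ0.le, Prod.mk.eta,
      SliceCollar.Ψinv_Ψ D.s₀_pos D.s₀_lt_one hP, radialProjection_smul _ hτ0, ptB]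
    rw [← hGz]
    congr 1
    refine Prod.ext ?_ ?_
    · show (1 - p.1) • ((radialProjection (spherePt 1) x : 𝕊 1) : 𝔼 2) = x
      rw [show p.1 = 1 - ‖x‖ from rfl, sub_sub_cancel, norm_smul_coe_radialProjection]
    · show p.2 • ((radialProjection (spherePt 1) w : 𝕊 1) : 𝔼 2) = w
      exact norm_smul_coe_radialProjection _ _
  · -- radial branch: `τ > 1` forces the right regime `r = τ ≥ 1`, `ℓ < s₀`
    rw [not_le] at h1
    obtain ⟨hr1, hℓs, hΨeq⟩ := D.right_of_one_lt_τ hP h1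
    rw [hΨeq]
    simp only
    rw [D.tube.ptY_eq jA hr0.ne']
    have hnot : D.tube.toFun (radialProjection (spherePt 1) x, p.2 • ((radialProjection (spherePt 1) w : 𝕊 1) : 𝔼 2)) ∉
        D.unitTube := by
      rw [mem_unitTube_iff, norm_smul_coe_sphere hr0.le, not_le]
      have : (SliceCollar.Ψ D.s₀ p).1 = p.2 := congrArg Prod.fst hΨeq
      linarith
    rw [D.collar_of_not_mem_unitTube hG _ hnot, cRad]
    simp only [neg_neg]
    rw [Real.exp_log (SliceCollar.E_pos D.s₀_pos hℓ0 hℓs), SliceCollar.Einv_E D.s₀_pos hℓ0 hℓs,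
      show p.1 = 1 - ‖x‖ from rfl, show p.2 = ‖w‖ from rfl, sub_sub_cancel, norm_smul_coe_radialProjection, ← hGz]
    exact (D.G_eq_smul (by linarith [D.s₀_lt]) hx1 hw2).symm

/-- **branch F'**: `collar (collarInv z) = z` on the centre fibre (normal rays over the disc centre) [folklore] -/
theorem collar_collarInv_flat (hG : D.tube.IsSurgeryWith jA jB) {z : 𝔼 4} (hz : z ∉ D.radSetT) (hN : z ∈ D.N)
    (hx : (D.Ginv z).1 = 0) (hdisc : z ∉ D.disc) (hcore : z ∉ D.core) :
    D.collar jA jB (D.collarInv jA jB z) = z := by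
  have hq := D.Ginv_mem hN
  have hGz := D.G_Ginv hN
  have hw : (D.Ginv z).2 ≠ 0 := D.snd_ne_zero_of_not_mem_disc hq (by rw [hGz]; exact hdisc)
  have hwpos : 0 < ‖(D.Ginv z).2‖ := norm_pos_iff.2 hw
  have hw1 : ‖(D.Ginv z).2‖ < 1 := D.norm_snd_lt_one hq (by rw [hGz]; exact hcore) (by rw [hx]; simp; linarith [D.s₀_lt_one])
  have hE : 0 < SliceCollar.E 1 ‖(D.Ginv z).2‖ := SliceCollar.E_pos one_pos hwpos hw1
  have hsolid : ((0 : 𝔼 2), radialProjection (spherePt 1) (D.Ginv z).2) ∈ solidTorus := by simp [mem_solidTorus_iff]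
  rw [D.collarInv_of_fst_eq_zero hz hx, ΨFlat, hx]
  simp only [smul_zero]
  rw [TubeNbhd.jBt_of_norm_lt jB (by simp), D.collar_of_core hG _ hsolid, cFlat]
  simp only [smul_zero, neg_neg]
  rw [Real.exp_log hE, SliceCollar.Einv_E one_pos hwpos hw1, norm_smul_coe_radialProjection]
  conv_rhs => rw [← hGz]
  rw [show D.Ginv z = ((D.Ginv z).1, (D.Ginv z).2) from rfl, hx]

/-- A point of the collar region outside the radial region lies in the tube `N` [folklore] -/
theorem mem_N_of_region {z : 𝔼 4} (hz : z ∈ D.region) (hrad : z ∉ D.radSetT) : z ∈ D.N := by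
  obtain ⟨hz1, hdisc, hcore⟩ := hz
  by_contra hN
  rcases le_or_gt ‖z‖ (1 - D.s₀) with hle | hgt
  · -- deep and not in the tube: in the core
    refine hcore ⟨by simpa using hle, fun ⟨q, hq, hqz⟩ ↦ hN ⟨q, ?_, hqz⟩⟩
    rw [mem_prod, mem_ball, mem_ball, dist_zero_right, dist_zero_right] at hq
    exact mem_dom_iff.2 ⟨hq.1, hq.2.trans one_lt_two⟩
  · -- shallow with direction in the unit tube: a cone point, in the tube
    have hdir : radialProjection (spherePt 3) z ∈ D.unitTube := by
      by_contra h; exact hrad ⟨hgt, h⟩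
    obtain ⟨⟨u, w⟩, ⟨-, hw⟩, hq⟩ := hdir
    rw [mem_closedBall, dist_zero_right] at hw
    apply hN
    refine ⟨(‖z‖ • (u : 𝔼 2), w), mem_dom_iff.2 ⟨?_, by simp only; linarith⟩, ?_⟩
    · simp only; rw [norm_smul_coe_sphere (norm_nonneg _)]; exact hz1
    · rw [D.cone u ‖z‖ w (by linarith [D.s₀_lt]) hz1 (by linarith)]
      show ‖z‖ • ((D.tube.toFun (u, w) : 𝕊 3) : 𝔼 4) = z
      rw [hq, norm_smul_coe_radialProjection]

/-- **`collar ∘ collarInv = id` on the collar region** [folklore] -/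
theorem collar_collarInv (hG : D.tube.IsSurgeryWith jA jB) {z : 𝔼 4} (hz : z ∈ D.region) :
    D.collar jA jB (D.collarInv jA jB z) = z := by
  by_cases hrad : z ∈ D.radSetT
  · exact D.collar_collarInv_rad hG hrad hz.1
  · have hN := D.mem_N_of_region hz hrad
    by_cases hx : (D.Ginv z).1 = 0
    · exact D.collar_collarInv_flat hG hrad hN hx hz.2.1 hz.2.2
    · exact D.collar_collarInv_tube hG hrad hN hx hz.2.1 hz.2.2

end RightInverse

/-! ### The collar takes values in the collar region -/

section MemRegion

variable {Y : Type*} [TopologicalSpace Y] [ChartedSpace (𝔼 3) Y]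
  {jA : D.tube.complement → Y} {jB : ↥solidTorus → Y}

/-- A shallow disc point is a cone point: its direction is on the knot [folklore] -/
theorem direction_mem_range_of_mem_disc {z : 𝔼 4} (hz : z ∈ D.disc) (hzn : 1 - D.s₀ < ‖z‖) :
    radialProjection (spherePt 3) z ∈ range (K : 𝕊 1 → 𝕊 3) := by
  obtain ⟨x, hx, rfl⟩ := hz
  rw [mem_closedBall, dist_zero_right] at hx
  rcases lt_or_ge ‖x‖ (1 - D.s₁) with hdeep | hband
  · -- deep disc points are deep
    rw [← D.apply_zero x (by simp; linarith [D.s₁_pos])] at hzn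
    have := D.deep x 0 (by linarith [D.s₀_lt]) (by simp)
    linarith
  · -- band disc points are on the cone
    have hx0 : x ≠ 0 := by
      rintro rfl; simp at hband; linarith [D.s₁_lt]
    have hcone : D.g x = ‖x‖ • ((K (radialProjection (spherePt 1) x) : 𝕊 3) : 𝔼 4) := by
      conv_lhs => rw [← norm_smul_coe_radialProjection (spherePt 1) x]
      exact D.g_cone _ _ hband hx
    rw [hcone, radialProjection_smul _ (norm_pos_iff.2 hx0)]
    exact mem_range_self _

/-- The radial formula takes values in the collar region. [folklore] -/
theorem cRad_mem_region (a : D.tube.complement) (ha : (a : 𝕊 3) ∉ D.unitTube) (σ : ℝ) : D.cRad a σ ∈ D.region := by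
  have hℓ := SliceCollar.Einv_mem D.s₀_pos (Real.exp (-σ))
  have hpos : 0 < 1 - SliceCollar.Einv D.s₀ (Real.exp (-σ)) := by linarith [hℓ.2, D.s₀_lt_one]
  have hnorm : ‖D.cRad a σ‖ = 1 - SliceCollar.Einv D.s₀ (Real.exp (-σ)) := norm_smul_coe_sphere hpos.le _
  have hdir : radialProjection (spherePt 3) (D.cRad a σ) = a := radialProjection_smul _ hpos _
  have hgt : 1 - D.s₀ < ‖D.cRad a σ‖ := by rw [hnorm]; linarith [hℓ.2]
  refine ⟨by rw [hnorm]; linarith [hℓ.1], fun h ↦ ?_, fun h ↦ ?_⟩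
  · have := D.direction_mem_range_of_mem_disc h hgt
    rw [hdir] at this
    exact ha (D.range_subset_unitTube this)
  · have := h.1
    rw [mem_closedBall, dist_zero_right] at this
    linarith

/-- The tube point over a point of the L-shaped domain lies in the collar region. [folklore] -/
theorem ptB_mem_region {p : ℝ × ℝ} (hp : p ∈ SliceCollar.P D.s₀) (u v : 𝕊 1) : D.ptB p.1 p.2 u v ∈ D.region := by
  obtain ⟨hℓ0, hℓ1, hr0, hr2, hor⟩ := D.bounds_of_mem_P hp
  have hr2' : |p.2| < 2 := by rw [abs_of_pos hr0]; exact hr2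
  have hdom := ptB_arg_mem_dom hℓ0 hℓ1 hr2' u v
  refine ⟨?_, ?_, ?_⟩
  · have := D.maps_ball _ hdom
    rwa [mem_ball, dist_zero_right] at this
  · rw [ptB]
    refine D.G_not_mem_disc (mem_dom_iff.1 hdom).1 (mem_dom_iff.1 hdom).2 ?_
    exact smul_ne_zero hr0.ne' (ne_zero_of_mem_unit_sphere v)
  · rcases lt_or_ge p.2 1 with hr1 | hr1
    · -- normal radius `< 1`: inside `G(D̊² × B(0,1))`
      rintro ⟨-, h⟩
      exact h ⟨((1 - p.1) • (u : 𝔼 2), p.2 • (v : 𝔼 2)), ⟨by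
        rw [mem_ball, dist_zero_right, norm_smul_coe_sphere (by linarith)]; linarith, by
        rw [mem_ball, dist_zero_right, norm_smul_coe_sphere hr0.le]; exact hr1⟩, rfl⟩
    · -- normal radius `≥ 1`: then `ℓ < s₀`, a shallow cone point
      have hℓ : p.1 < D.s₀ := hor.resolve_right (not_lt.2 hr1)
      rintro ⟨h, -⟩
      rw [mem_closedBall, dist_zero_right, D.ptB_of_lt hℓ0 (hℓ.trans D.s₀_lt) hr2',
        norm_smul_coe_sphere (by linarith)] at h
      linarith

/-- The tube formula takes values in the collar region. [folklore] -/
theorem cTube_mem_region (a : D.tube.complement) (ha : (a : 𝕊 3) ∈ D.unitTube) (σ : ℝ) : D.cTube a σ ∈ D.region := by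
  obtain ⟨⟨u, w⟩, ⟨-, hw1⟩, hqa⟩ := ha
  rw [mem_closedBall, dist_zero_right] at hw1
  have hw : w ≠ 0 := fun h ↦ a.2 (by rw [← hqa, h, D.tube.apply_zero]; exact mem_range_self u)
  rw [← hqa, cTube_apply]
  exact D.ptB_mem_region (D.baseP_mem hw (by linarith) σ) _ _

/-- The flat formula over the core circle takes values in the collar region. [folklore] -/
theorem cFlat_zero_mem_region (v : 𝕊 1) (σ : ℝ) : D.cFlat ((0 : 𝔼 2), v) σ ∈ D.region := by
  have hr := SliceCollar.Einv_mem one_pos (Real.exp (-σ))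
  rw [cFlat]
  simp only [smul_zero]
  have hnv : ‖SliceCollar.Einv 1 (Real.exp (-σ)) • (v : 𝔼 2)‖ = SliceCollar.Einv 1 (Real.exp (-σ)) :=
    norm_smul_coe_sphere hr.1.le _
  have hdom : (((0 : 𝔼 2), SliceCollar.Einv 1 (Real.exp (-σ)) • (v : 𝔼 2)) : (𝔼 2) × (𝔼 2)) ∈ (dom : Set ((𝔼 2) × (𝔼 2))) :=
    mem_dom_iff.2 ⟨by simp, by rw [hnv]; linarith [hr.2]⟩
  refine ⟨?_, D.G_not_mem_disc (by simp) (by rw [hnv]; linarith [hr.2]) (smul_ne_zero hr.1.ne' (ne_zero_of_mem_unit_sphere v)), ?_⟩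
  · have := D.maps_ball _ hdom
    rwa [mem_ball, dist_zero_right] at this
  · rintro ⟨-, h⟩
    exact h ⟨((0 : 𝔼 2), SliceCollar.Einv 1 (Real.exp (-σ)) • (v : 𝔼 2)), ⟨by simp, by
      rw [mem_ball, dist_zero_right, hnv]; exact hr.2⟩, rfl⟩

/-- **the collar takes values in the collar region** [folklore] -/
theorem collar_mem_region (hG : D.tube.IsSurgeryWith jA jB) (p : Y × ℝ) : D.collar jA jB p ∈ D.region := by
  obtain ⟨y, σ⟩ := p
  by_cases hy : y ∈ range jA
  · obtain ⟨a, rfl⟩ := hy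
    by_cases ha : (a : 𝕊 3) ∈ D.unitTube
    · rw [D.collar_of_mem_unitTube hG a ha]; exact D.cTube_mem_region a ha σ
    · rw [D.collar_of_not_mem_unitTube hG a ha]; exact D.cRad_mem_region a ha σ
  · obtain ⟨v, h, rfl⟩ := D.tube.eq_jB_zero_of_not_mem_range hG hy
    rw [D.collar_of_core hG v h]; exact D.cFlat_zero_mem_region v σ

/-- The collar is injective. [folklore] -/
theorem collar_injective (hG : D.tube.IsSurgeryWith jA jB) : Injective (D.collar jA jB) :=
  fun p p' h ↦ by rw [← D.collarInv_collar hG p, ← D.collarInv_collar hG p', h]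

/-- The inverse collar is injective on the collar region. [folklore] -/
theorem collarInv_injOn (hG : D.tube.IsSurgeryWith jA jB) : InjOn (D.collarInv jA jB) D.region :=
  fun z hz z' hz' h ↦ by rw [← D.collar_collarInv hG hz, ← D.collar_collarInv hG hz', h]

/-- **the image of the collar is the collar region** [folklore] -/
theorem range_collar (hG : D.tube.IsSurgeryWith jA jB) : range (D.collar jA jB) = D.region := by
  refine Subset.antisymm ?_ fun z hz ↦ ⟨_, D.collar_collarInv hG hz⟩
  rintro _ ⟨p, rfl⟩; exact D.collar_mem_region hG p

end MemRegion

/-! ### Agreement of the local formulas on overlaps -/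

section Agreement

variable {Y : Type*} {jA : D.tube.complement → Y} {jB : ↥solidTorus → Y}

/-- **R = P on the overlap**: over `ν (u, w)` with `1 ≤ ‖w‖ < 2` the radial and tube formulas agree
(right regime of the inverse profile) [folklore] -/
theorem cRad_eq_cTube (u : 𝕊 1) {w : 𝔼 2} (hw1 : 1 ≤ ‖w‖) (hw2 : ‖w‖ < 2) (σ : ℝ) :
    D.cRad (D.tube.toFun (u, w)) σ = D.cTube (D.tube.toFun (u, w)) σ := by
  have hwpos : 0 < ‖w‖ := by linarith
  have hℓ := SliceCollar.Einv_mem D.s₀_pos (Real.exp (-σ))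
  rw [cTube_apply, baseP_apply, SliceCollar.Ψinv_of_one_le D.s₀_pos D.s₀_lt_one (q := (‖w‖, σ)) hw1 hw2]
  simp only
  rw [D.ptB_of_lt hℓ.1 (hℓ.2.trans D.s₀_lt) (by rw [abs_of_pos hwpos]; exact hw2), norm_smul_coe_radialProjection, cRad]

/-- **P = F on the overlap**: for `0 < ‖p‖ ≤ (1 - s₀)/4` the tube formula at `ν (p̂, ‖p‖ v)` is the flat formula
at `(p, v)` (deep regime of the inverse profile) [folklore] -/
theorem cTube_eq_cFlat {pv : 𝔼 2} (hp : pv ≠ 0) (hp1 : ‖pv‖ ≤ (1 - D.s₀) / 4) (v : 𝕊 1) (σ : ℝ) :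
    D.cTube (D.tube.toFun (radialProjection (spherePt 1) pv, ‖pv‖ • (v : 𝔼 2))) σ = D.cFlat (pv, v) σ := by
  have hppos : 0 < ‖pv‖ := norm_pos_iff.2 hp
  have hn : ‖‖pv‖ • (v : 𝔼 2)‖ = ‖pv‖ := norm_smul_coe_sphere hppos.le _
  rw [cTube_apply, baseP_apply, hn, SliceCollar.Ψinv_of_le D.s₀_pos D.s₀_lt_one (q := (‖pv‖, σ)) hppos
    (by rw [SliceCollar.T]; exact hp1)]
  simp only
  rw [radialProjection_smul _ hppos, ptB, cFlat]
  congr 2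
  rw [sub_sub_cancel, coe_radialProjection_of_ne_zero _ hp, smul_smul]
  field_simp

/-- **R' = P' on the overlap**: at a cone point `G (x, w)` with `1 - s₀ < ‖x‖ < 1` and `1 ≤ ‖w‖ < 2` [folklore] -/
theorem ΨRad_eq_ΨTube (jA : D.tube.complement → Y) {x w : 𝔼 2} (hx1 : 1 - D.s₀ < ‖x‖) (hx2 : ‖x‖ < 1)
    (hw1 : 1 ≤ ‖w‖) (hw2 : ‖w‖ < 2) : D.ΨRad jA (D.G (x, w)) = D.ΨTube jA (D.G (x, w)) := by
  have hxpos : 0 < ‖x‖ := by linarith [D.s₀_lt_one]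
  have hwpos : 0 < ‖w‖ := by linarith
  have hdom : ((x, w) : (𝔼 2) × (𝔼 2)) ∈ (dom : Set ((𝔼 2) × (𝔼 2))) := mem_dom_iff.2 ⟨hx2, hw2⟩
  have hz : D.G (x, w) = ‖x‖ • ((D.tube.toFun (radialProjection (spherePt 1) x, w) : 𝕊 3) : 𝔼 4) :=
    D.G_eq_smul (by linarith [D.s₀_lt]) hx2 hw2
  have hΨ : SliceCollar.Ψ D.s₀ (1 - ‖x‖, ‖w‖) = (‖w‖, -Real.log (SliceCollar.E D.s₀ (1 - ‖x‖))) := by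
    rw [SliceCollar.Ψ_of_one_le D.s₀ (p := (1 - ‖x‖, ‖w‖)) hwpos hw1, SliceCollar.R_of_one_le hw1]
  rw [ΨTube, profB, D.Ginv_apply hdom, ΨRad, hz, radialProjection_smul _ hxpos, norm_smul_coe_sphere hxpos.le]
  simp only [hΨ]
  refine Prod.ext ?_ rfl
  show D.tube.jAt jA (D.tube.toFun (radialProjection (spherePt 1) x, w)) = D.tube.ptY jA ‖w‖ (radialProjection (spherePt 1) x)
    (radialProjection (spherePt 1) w)
  rw [TubeNbhd.ptY, norm_smul_coe_radialProjection]

/-- **P' = F' on the overlap**: at a deep tube point `G (x, w)` with `0 < ‖x‖ < 1 - s₀`, `0 < ‖w‖ < 1` [folklore] -/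
theorem ΨTube_eq_ΨFlat [TopologicalSpace Y] [ChartedSpace (𝔼 3) Y] (hG : D.tube.IsSurgeryWith jA jB) {x w : 𝔼 2} (hx : x ≠ 0)
    (hx1 : ‖x‖ ≤ 1 - D.s₀) (hw : w ≠ 0) (hw1 : ‖w‖ < 1) : D.ΨTube jA (D.G (x, w)) = D.ΨFlat jB (D.G (x, w)) := by
  have hxpos : 0 < ‖x‖ := norm_pos_iff.2 hx
  have hwpos : 0 < ‖w‖ := norm_pos_iff.2 hw
  have hdom : ((x, w) : (𝔼 2) × (𝔼 2)) ∈ (dom : Set ((𝔼 2) × (𝔼 2))) := mem_dom_iff.2 ⟨by linarith [D.s₀_pos], by linarith⟩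
  have hΨ : SliceCollar.Ψ D.s₀ (1 - ‖x‖, ‖w‖) = (SliceCollar.T (1 - ‖x‖), -Real.log (SliceCollar.E 1 ‖w‖)) :=
    SliceCollar.Ψ_of_le D.s₀_pos (p := (1 - ‖x‖, ‖w‖)) (by simp only; linarith [D.s₀_pos]) (by simp only; linarith) hwpos hw1
  rw [ΨTube, profB, D.Ginv_apply hdom, ΨFlat, D.Ginv_apply hdom]
  simp only [hΨ, SliceCollar.T, sub_sub_cancel]
  refine Prod.ext ?_ rfl
  show D.tube.ptY jA (‖x‖ / 4) (radialProjection (spherePt 1) x) (radialProjection (spherePt 1) w) =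
    TubeNbhd.jBt jB ((4 : ℝ)⁻¹ • x, radialProjection (spherePt 1) w)
  rw [D.tube.ptY_eq_jB hG (by positivity) (by linarith [D.s₀_pos]), coe_radialProjection_of_ne_zero _ hx, smul_smul]
  congr 2
  field_simp

end Agreement

/-! ### Smoothness of the three collar formulas in coordinates -/

section SmoothFormulas

/-- The radial formula in coordinates [folklore] -/
def fR (q : (𝕊 3) × ℝ) : 𝔼 4 := (1 - SliceCollar.Einv D.s₀ (Real.exp (-q.2))) • ((q.1 : 𝕊 3) : 𝔼 4)

/-- The radial formula is `fR` (definitionally). [folklore] -/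
theorem cRad_eq_fR (a : 𝕊 3) (σ : ℝ) : D.cRad a σ = D.fR (a, σ) := rfl

/-- The radial formula is smooth. [folklore] -/
theorem contMDiff_fR : ContMDiff ((𝓡 3).prod 𝓘(ℝ, ℝ)) 𝓘(ℝ, 𝔼 4) ∞ D.fR := by
  haveI : Fact (Module.finrank ℝ (𝔼 4) = 3 + 1) := ⟨by simp⟩
  intro q
  have h1 : ContMDiffAt ((𝓡 3).prod 𝓘(ℝ, ℝ)) 𝓘(ℝ, 𝔼 4) ∞ (fun q : (𝕊 3) × ℝ ↦ ((q.1 : 𝕊 3) : 𝔼 4)) q :=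
    ((contMDiff_coe_sphere (E := 𝔼 4) (n := 3)).comp contMDiff_fst).contMDiffAt
  have h2 : ContMDiffAt ((𝓡 3).prod 𝓘(ℝ, ℝ)) 𝓘(ℝ, ℝ) ∞ (fun q : (𝕊 3) × ℝ ↦ 1 - SliceCollar.Einv D.s₀ (Real.exp (-q.2))) q := by
    have he : ContDiffAt ℝ ∞ (fun σ : ℝ ↦ Real.exp (-σ)) q.2 := (Real.contDiff_exp.comp contDiff_neg).contDiffAt
    have ht : ContDiffAt ℝ ∞ (fun σ : ℝ ↦ 1 - SliceCollar.Einv D.s₀ (Real.exp (-σ))) q.2 :=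
      contDiffAt_const.sub (ContDiffAt.comp (g := SliceCollar.Einv D.s₀) (f := fun σ : ℝ ↦ Real.exp (-σ)) q.2
        (SliceCollar.contDiffAt_Einv D.s₀_pos (Real.exp_pos _)) he)
    exact ht.contMDiffAt.comp q contMDiff_snd.contMDiffAt
  exact (TubeNbhd.contDiff_smul_pair (𝔼 4)).contMDiff.contMDiffAt.comp q (h2.prodMk_space h1)

/-- The tube formula in coordinates `((u, w), σ) ↦ G ((1 - ℓ) u, r ŵ)`, `(ℓ, r) = Ψ⁻¹ (‖w‖, σ)` [folklore] -/
def fP (q : ((𝕊 1) × (𝔼 2)) × ℝ) : 𝔼 4 :=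
  D.G ((1 - (SliceCollar.Ψinv D.s₀ (‖q.1.2‖, q.2)).1) • ((q.1.1 : 𝕊 1) : 𝔼 2),
    (SliceCollar.Ψinv D.s₀ (‖q.1.2‖, q.2)).2 • ((radialProjection (spherePt 1) q.1.2 : 𝕊 1) : 𝔼 2))

/-- The tube formula is `fP` in tube coordinates (definitionally). [folklore] -/
theorem cTube_eq_fP (a : 𝕊 3) (σ : ℝ) : D.cTube a σ = D.fP (D.tube.toHomeo.symm a, σ) := rfl

/-- The set where the tube formula is used: `w ≠ 0`, `‖w‖ < 2` [folklore] -/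
def fPdom : Set (((𝕊 1) × (𝔼 2)) × ℝ) := {q | q.1.2 ≠ 0 ∧ ‖q.1.2‖ < 2}

/-- The set where the tube formula is used is open. [folklore] -/
theorem isOpen_fPdom : IsOpen (fPdom : Set (((𝕊 1) × (𝔼 2)) × ℝ)) := by
  have h1 : IsOpen {q : ((𝕊 1) × (𝔼 2)) × ℝ | q.1.2 ≠ 0} := isOpen_ne.preimage (continuous_snd.comp continuous_fst)
  have h2 : IsOpen {q : ((𝕊 1) × (𝔼 2)) × ℝ | ‖q.1.2‖ < 2} :=
    isOpen_lt (continuous_norm.comp (continuous_snd.comp continuous_fst)) continuous_const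
  exact h1.inter h2

/-- The tube formula is smooth in tube coordinates where `0 < ‖w‖ < 2`. [folklore] -/
theorem contMDiffOn_fP : ContMDiffOn (((𝓡 1).prod 𝓘(ℝ, 𝔼 2)).prod 𝓘(ℝ, ℝ)) 𝓘(ℝ, 𝔼 4) ∞ D.fP fPdom := by
  haveI : Fact (Module.finrank ℝ (𝔼 2) = 1 + 1) := ⟨by simp⟩
  rintro q ⟨hq, hq2⟩
  -- the profile coordinates
  have hstrip : (‖q.1.2‖, q.2) ∈ SliceCollar.Strip := ⟨⟨norm_pos_iff.2 hq, hq2⟩, mem_univ _⟩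
  have hbase : ContMDiffAt (((𝓡 1).prod 𝓘(ℝ, 𝔼 2)).prod 𝓘(ℝ, ℝ)) 𝓘(ℝ, ℝ × ℝ) ∞
      (fun q : ((𝕊 1) × (𝔼 2)) × ℝ ↦ SliceCollar.Ψinv D.s₀ (‖q.1.2‖, q.2)) q := by
    have h1 : ContMDiffAt (((𝓡 1).prod 𝓘(ℝ, 𝔼 2)).prod 𝓘(ℝ, ℝ)) 𝓘(ℝ, ℝ) ∞
        (fun q : ((𝕊 1) × (𝔼 2)) × ℝ ↦ ‖q.1.2‖) q :=
      (contDiffAt_norm ℝ hq).contMDiffAt.comp q (contMDiff_snd.comp contMDiff_fst).contMDiffAt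
    have h2 : ContMDiffAt (((𝓡 1).prod 𝓘(ℝ, 𝔼 2)).prod 𝓘(ℝ, ℝ)) 𝓘(ℝ, ℝ) ∞ (fun q : ((𝕊 1) × (𝔼 2)) × ℝ ↦ q.2) q :=
      contMDiff_snd.contMDiffAt
    exact ContMDiffAt.comp (g := SliceCollar.Ψinv D.s₀) (f := fun q : ((𝕊 1) × (𝔼 2)) × ℝ ↦ (‖q.1.2‖, q.2)) q
      (SliceCollar.contDiffAt_Ψinv D.s₀_pos D.s₀_lt_one hstrip).contMDiffAt (h1.prodMk_space h2)
  have hP := SliceCollar.Ψinv_mem D.s₀_pos D.s₀_lt_one hstrip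
  obtain ⟨hℓ0, hℓ1, hr0, hr2, -⟩ := D.bounds_of_mem_P hP
  -- the two arguments of `G`
  have hx : ContMDiffAt (((𝓡 1).prod 𝓘(ℝ, 𝔼 2)).prod 𝓘(ℝ, ℝ)) 𝓘(ℝ, 𝔼 2) ∞
      (fun q : ((𝕊 1) × (𝔼 2)) × ℝ ↦ (1 - (SliceCollar.Ψinv D.s₀ (‖q.1.2‖, q.2)).1) • ((q.1.1 : 𝕊 1) : 𝔼 2)) q := by
    have hs : ContMDiffAt (((𝓡 1).prod 𝓘(ℝ, 𝔼 2)).prod 𝓘(ℝ, ℝ)) 𝓘(ℝ, ℝ) ∞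
        (fun q : ((𝕊 1) × (𝔼 2)) × ℝ ↦ 1 - (SliceCollar.Ψinv D.s₀ (‖q.1.2‖, q.2)).1) q :=
      ContMDiffAt.comp (g := fun r : ℝ × ℝ ↦ 1 - r.1) (f := fun q : ((𝕊 1) × (𝔼 2)) × ℝ ↦ SliceCollar.Ψinv D.s₀ (‖q.1.2‖, q.2)) q
        (contDiffAt_const.sub contDiffAt_fst).contMDiffAt hbase
    have hu : ContMDiffAt (((𝓡 1).prod 𝓘(ℝ, 𝔼 2)).prod 𝓘(ℝ, ℝ)) 𝓘(ℝ, 𝔼 2) ∞ (fun q : ((𝕊 1) × (𝔼 2)) × ℝ ↦ ((q.1.1 : 𝕊 1) : 𝔼 2)) q :=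
      ((contMDiff_coe_sphere (E := 𝔼 2) (n := 1)).comp (contMDiff_fst.comp contMDiff_fst)).contMDiffAt
    exact (TubeNbhd.contDiff_smul_pair (𝔼 2)).contMDiff.contMDiffAt.comp q (hs.prodMk_space hu)
  have hw : ContMDiffAt (((𝓡 1).prod 𝓘(ℝ, 𝔼 2)).prod 𝓘(ℝ, ℝ)) 𝓘(ℝ, 𝔼 2) ∞
      (fun q : ((𝕊 1) × (𝔼 2)) × ℝ ↦ (SliceCollar.Ψinv D.s₀ (‖q.1.2‖, q.2)).2 • ((radialProjection (spherePt 1) q.1.2 : 𝕊 1) : 𝔼 2)) q := by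
    have hs : ContMDiffAt (((𝓡 1).prod 𝓘(ℝ, 𝔼 2)).prod 𝓘(ℝ, ℝ)) 𝓘(ℝ, ℝ) ∞
        (fun q : ((𝕊 1) × (𝔼 2)) × ℝ ↦ (SliceCollar.Ψinv D.s₀ (‖q.1.2‖, q.2)).2) q :=
      ContMDiffAt.comp (g := fun r : ℝ × ℝ ↦ r.2) (f := fun q : ((𝕊 1) × (𝔼 2)) × ℝ ↦ SliceCollar.Ψinv D.s₀ (‖q.1.2‖, q.2)) q
        contDiffAt_snd.contMDiffAt hbase
    have hv : ContMDiffAt (((𝓡 1).prod 𝓘(ℝ, 𝔼 2)).prod 𝓘(ℝ, ℝ)) 𝓘(ℝ, 𝔼 2) ∞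
        (fun q : ((𝕊 1) × (𝔼 2)) × ℝ ↦ ((radialProjection (spherePt 1) q.1.2 : 𝕊 1) : 𝔼 2)) q := by
      have hr : ContMDiffAt 𝓘(ℝ, 𝔼 2) (𝓡 1) ∞ (radialProjection (spherePt 1)) q.1.2 :=
        (contMDiffOn_radialProjection (spherePt 1)).contMDiffAt (isOpen_ne.mem_nhds hq)
      exact (contMDiff_coe_sphere (E := 𝔼 2) (n := 1)).contMDiffAt.comp q (hr.comp q (contMDiff_snd.comp contMDiff_fst).contMDiffAt)
    exact (TubeNbhd.contDiff_smul_pair (𝔼 2)).contMDiff.contMDiffAt.comp q (hs.prodMk_space hv)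
  -- the argument lies in the domain of `G`
  have hdom : (((1 - (SliceCollar.Ψinv D.s₀ (‖q.1.2‖, q.2)).1) • ((q.1.1 : 𝕊 1) : 𝔼 2),
      (SliceCollar.Ψinv D.s₀ (‖q.1.2‖, q.2)).2 • ((radialProjection (spherePt 1) q.1.2 : 𝕊 1) : 𝔼 2)) : (𝔼 2) × (𝔼 2)) ∈
      (dom : Set ((𝔼 2) × (𝔼 2))) := ptB_arg_mem_dom hℓ0 hℓ1 (by rw [abs_of_pos hr0]; exact hr2) _ _
  exact (ContMDiffAt.comp (g := D.G) q (D.contDiffAt_G hdom).contMDiffAt (hx.prodMk_space hw)).contMDiffWithinAt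

/-- The flat formula in coordinates [folklore] -/
def fF (q : ((𝔼 2) × (𝕊 1)) × ℝ) : 𝔼 4 := D.G ((4 : ℝ) • q.1.1, SliceCollar.Einv 1 (Real.exp (-q.2)) • ((q.1.2 : 𝕊 1) : 𝔼 2))

/-- The flat formula is `fF` (definitionally). [folklore] -/
theorem cFlat_eq_fF (b : (𝔼 2) × (𝕊 1)) (σ : ℝ) : D.cFlat b σ = D.fF (b, σ) := rfl

/-- The flat formula is smooth where `‖p‖ < 1/4`. [folklore] -/
theorem contMDiffOn_fF : ContMDiffOn ((𝓘(ℝ, 𝔼 2).prod (𝓡 1)).prod 𝓘(ℝ, ℝ)) 𝓘(ℝ, 𝔼 4) ∞ D.fF {q | ‖q.1.1‖ < 4⁻¹} := by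
  haveI : Fact (Module.finrank ℝ (𝔼 2) = 1 + 1) := ⟨by simp⟩
  intro q hq
  have hq' : ‖q.1.1‖ < 4⁻¹ := hq
  have hr := SliceCollar.Einv_mem one_pos (Real.exp (-q.2))
  have hp : ContMDiffAt ((𝓘(ℝ, 𝔼 2).prod (𝓡 1)).prod 𝓘(ℝ, ℝ)) 𝓘(ℝ, 𝔼 2) ∞ (fun q : ((𝔼 2) × (𝕊 1)) × ℝ ↦ (4 : ℝ) • q.1.1) q :=
    ((contDiff_const_smul (4 : ℝ)).contMDiff.comp (contMDiff_fst.comp contMDiff_fst)).contMDiffAt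
  have hw : ContMDiffAt ((𝓘(ℝ, 𝔼 2).prod (𝓡 1)).prod 𝓘(ℝ, ℝ)) 𝓘(ℝ, 𝔼 2) ∞
      (fun q : ((𝔼 2) × (𝕊 1)) × ℝ ↦ SliceCollar.Einv 1 (Real.exp (-q.2)) • ((q.1.2 : 𝕊 1) : 𝔼 2)) q := by
    have hs : ContMDiffAt ((𝓘(ℝ, 𝔼 2).prod (𝓡 1)).prod 𝓘(ℝ, ℝ)) 𝓘(ℝ, ℝ) ∞
        (fun q : ((𝔼 2) × (𝕊 1)) × ℝ ↦ SliceCollar.Einv 1 (Real.exp (-q.2))) q := by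
      have he : ContDiffAt ℝ ∞ (fun σ : ℝ ↦ Real.exp (-σ)) q.2 := (Real.contDiff_exp.comp contDiff_neg).contDiffAt
      have ht : ContDiffAt ℝ ∞ (fun σ : ℝ ↦ SliceCollar.Einv 1 (Real.exp (-σ))) q.2 :=
        ContDiffAt.comp (g := SliceCollar.Einv 1) (f := fun σ : ℝ ↦ Real.exp (-σ)) q.2
          (SliceCollar.contDiffAt_Einv one_pos (Real.exp_pos _)) he
      exact ht.contMDiffAt.comp q contMDiff_snd.contMDiffAt
    have hv : ContMDiffAt ((𝓘(ℝ, 𝔼 2).prod (𝓡 1)).prod 𝓘(ℝ, ℝ)) 𝓘(ℝ, 𝔼 2) ∞ (fun q : ((𝔼 2) × (𝕊 1)) × ℝ ↦ ((q.1.2 : 𝕊 1) : 𝔼 2)) q :=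
      ((contMDiff_coe_sphere (E := 𝔼 2) (n := 1)).comp (contMDiff_snd.comp contMDiff_fst)).contMDiffAt
    exact (TubeNbhd.contDiff_smul_pair (𝔼 2)).contMDiff.contMDiffAt.comp q (hs.prodMk_space hv)
  have hdom : (((4 : ℝ) • q.1.1, SliceCollar.Einv 1 (Real.exp (-q.2)) • ((q.1.2 : 𝕊 1) : 𝔼 2)) : (𝔼 2) × (𝔼 2)) ∈
      (dom : Set ((𝔼 2) × (𝔼 2))) := by
    refine mem_dom_iff.2 ⟨?_, ?_⟩
    · simp only; rw [norm_smul, Real.norm_of_nonneg (by norm_num : (0 : ℝ) ≤ 4)]; linarith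
    · simp only; rw [norm_smul_coe_sphere hr.1.le]; linarith [hr.2]
  exact (ContMDiffAt.comp (g := D.G) q (D.contDiffAt_G hdom).contMDiffAt (hp.prodMk_space hw)).contMDiffWithinAt

end SmoothFormulas

/-! ### Smoothness of the collar -/

section SmoothCollar

variable {Y : Type*} [TopologicalSpace Y] [ChartedSpace (𝔼 3) Y]
  {jA : D.tube.complement → Y} {jB : ↥solidTorus → Y}

/-- The punctured tube of radius `2` in `S³` [folklore] -/
def puncturedTube₂ : Set (𝕊 3) := D.tube.toFun '' ((univ : Set (𝕊 1)) ×ˢ (ball (0 : 𝔼 2) 2 \ {0}))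

/-- The punctured tube of radius `2` is open. [folklore] -/
theorem isOpen_puncturedTube₂ : IsOpen D.puncturedTube₂ :=
  D.tube.isOpenEmbedding.isOpenMap _ (isOpen_univ.prod (isOpen_ball.sdiff isClosed_singleton))

/-- `ν (u, w)` lies in the punctured tube of radius `2` iff `0 < ‖w‖ < 2`. [folklore] -/
theorem mem_puncturedTube₂_iff {u : 𝕊 1} {w : 𝔼 2} : D.tube.toFun (u, w) ∈ D.puncturedTube₂ ↔ w ≠ 0 ∧ ‖w‖ < 2 := by
  rw [puncturedTube₂, D.tube.injective.mem_set_image]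
  simp only [mem_prod, mem_univ, true_and, mem_sdiff, mem_ball, dist_zero_right, mem_singleton_iff]
  tauto

/-- The tube part of `Y` [folklore] -/
def tubeSet (jA : D.tube.complement → Y) : Set Y := jA '' {a | (a : 𝕊 3) ∈ D.puncturedTube₂}

/-- The tube part of `Y` is open. [folklore] -/
theorem isOpen_tubeSet (hG : D.tube.IsSurgeryWith jA jB) : IsOpen (D.tubeSet jA) :=
  (D.tube.isOpenEmbedding_jA hG).isOpenMap _ (D.isOpen_puncturedTube₂.preimage continuous_subtype_val)

/-- The radial part of `Y` is open. [folklore] -/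
theorem isOpen_radSet (hG : D.tube.IsSurgeryWith jA jB) : IsOpen (D.radSet jA) :=
  (D.tube.isOpenEmbedding_jA hG).isOpenMap _ (D.isClosed_unitTube.isOpen_compl.preimage continuous_subtype_val)

/-- On the tube part the collar is the tube formula [folklore] -/
theorem collar_eq_fP_of_mem_tubeSet (hG : D.tube.IsSurgeryWith jA jB) {p : Y × ℝ} (hp : p.1 ∈ D.tubeSet jA) :
    D.collar jA jB p = D.fP (D.tube.toHomeo.symm (D.tube.invA jA p.1), p.2) := by
  obtain ⟨y, σ⟩ := p
  obtain ⟨a, ha, rfl⟩ := hp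
  simp only at ha ⊢
  rw [D.tube.invA_apply hG, ← cTube_eq_fP]
  by_cases hc : (a : 𝕊 3) ∈ D.unitTube
  · exact D.collar_of_mem_unitTube hG a hc σ
  · rw [D.collar_of_not_mem_unitTube hG a hc]
    obtain ⟨⟨u, w⟩, huw, hq⟩ := ha
    have hw : w ≠ 0 ∧ ‖w‖ < 2 := by
      simp only [mem_prod, mem_univ, true_and, mem_sdiff, mem_ball, dist_zero_right, mem_singleton_iff] at huw
      exact ⟨huw.2, huw.1⟩
    have hw1 : 1 ≤ ‖w‖ := by
      by_contra h
      exact hc (hq ▸ (D.mem_unitTube_iff).2 (not_le.1 h).le)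
    rw [← hq]
    exact D.cRad_eq_cTube u hw1 hw.2 σ

/-- Outside the closed unit tube the collar is the radial formula [folklore] -/
theorem collar_eq_fR_of_mem_radSet (hG : D.tube.IsSurgeryWith jA jB) {p : Y × ℝ} (hp : p.1 ∈ D.radSet jA) :
    D.collar jA jB p = D.fR (D.tube.invA jA p.1, p.2) := by
  obtain ⟨y, σ⟩ := p
  obtain ⟨a, ha, rfl⟩ := hp
  simp only at ha ⊢
  rw [D.tube.invA_apply hG, ← cRad_eq_fR]
  exact D.collar_of_not_mem_unitTube hG a ha σ

/-- The flat part of `Y`: the solid-torus points with `‖p‖ < (1 - s₀)/4` [folklore] -/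
def flatSetY (jB : ↥solidTorus → Y) : Set Y := jB '' {b | ‖(b : (𝔼 2) × (𝕊 1)).1‖ < (1 - D.s₀) / 4}

/-- The flat part of `Y` is open. [folklore] -/
theorem isOpen_flatSetY (hG : D.tube.IsSurgeryWith jA jB) : IsOpen (D.flatSetY jB) :=
  (D.tube.isOpenEmbedding_jB hG).isOpenMap _
    (isOpen_lt (continuous_norm.comp (continuous_fst.comp continuous_subtype_val)) continuous_const)

/-- On the flat part the collar is the flat formula [folklore] -/
theorem collar_eq_fF_of_mem_flatSetY (hG : D.tube.IsSurgeryWith jA jB) {p : Y × ℝ} (hp : p.1 ∈ D.flatSetY jB) :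
    D.collar jA jB p = D.fF (TubeNbhd.invB jB p.1, p.2) := by
  obtain ⟨y, σ⟩ := p
  obtain ⟨⟨⟨pv, v⟩, hb⟩, hlt, rfl⟩ := hp
  simp only at hlt ⊢
  rw [TubeNbhd.invB_apply _ hG, ← cFlat_eq_fF]
  simp only
  by_cases hpv : pv = 0
  · subst hpv
    exact D.collar_of_core hG v hb σ
  · have hlt1 : ‖pv‖ < 1 := (mem_solidTorus_iff (pv, v)).1 hb
    have hpos : 0 < ‖pv‖ := norm_pos_iff.2 hpv
    set a : D.tube.complement := ⟨D.tube.toFun (radialProjection (spherePt 1) pv, ‖pv‖ • (v : 𝔼 2)),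
      D.tube.apply_smul_not_mem_range hpos.ne' _ _⟩ with hadef
    have hya : jB ⟨(pv, v), hb⟩ = jA a := by
      rw [eq_comm, D.tube.jA_eq_jB_iff hG]
      exact ⟨_, _, ⟨hpos, hlt1⟩, (norm_smul_coe_radialProjection _ _).symm, rfl⟩
    have hmem : (a : 𝕊 3) ∈ D.unitTube := by
      show D.tube.toFun _ ∈ _
      rw [mem_unitTube_iff, norm_smul_coe_sphere hpos.le]; linarith [D.s₀_pos]
    rw [hya, D.collar_of_mem_unitTube hG a hmem]
    exact D.cTube_eq_cFlat hpv hlt.le v σ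

/-- Points over the core circle of the surgery torus lie in the flat part. [folklore] -/
theorem mem_flatSetY_of_not_mem_range (hG : D.tube.IsSurgeryWith jA jB) {p : Y × ℝ} (hp : p.1 ∉ range jA) :
    p.1 ∈ D.flatSetY jB := by
  obtain ⟨v, h, hy⟩ := D.tube.eq_jB_zero_of_not_mem_range hG hp
  refine ⟨⟨_, h⟩, ?_, hy⟩
  show ‖(0 : 𝔼 2)‖ < (1 - D.s₀) / 4
  rw [norm_zero]; linarith [D.s₀_lt_one]

omit [TopologicalSpace Y] [ChartedSpace (𝔼 3) Y] in
/-- Every point of `Y` is in the tube part, in the radial part, or on the core circle. [folklore] -/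
theorem mem_tubeSet_or (jA : D.tube.complement → Y) (y : Y) :
    y ∈ D.tubeSet jA ∨ y ∈ D.radSet jA ∨ y ∉ range jA := by
  by_cases hy : y ∈ range jA
  · obtain ⟨a, rfl⟩ := hy
    by_cases ha : (a : 𝕊 3) ∈ D.puncturedTube₂
    · exact Or.inl ⟨a, ha, rfl⟩
    · refine Or.inr (Or.inl ⟨a, fun h ↦ ha ?_, rfl⟩)
      obtain ⟨⟨u, w⟩, ⟨-, hw⟩, hq⟩ := h
      rw [mem_closedBall, dist_zero_right] at hw
      have hw0 : w ≠ 0 := fun h0 ↦ a.2 (by rw [← hq, h0, D.tube.apply_zero]; exact mem_range_self u)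
      rw [← hq, mem_puncturedTube₂_iff]
      exact ⟨hw0, by linarith⟩
  · exact Or.inr (Or.inr hy)

/-- **the collar is smooth** [folklore] -/
theorem contMDiff_collar (hG : D.tube.IsSurgeryWith jA jB) :
    ContMDiff ((𝓡 3).prod 𝓘(ℝ, ℝ)) 𝓘(ℝ, 𝔼 4) ∞ (D.collar jA jB) := by
  intro p
  rcases D.mem_tubeSet_or jA p.1 with hp | hp | hp
  · -- tube part
    have hopen : IsOpen ((D.tubeSet jA) ×ˢ (univ : Set ℝ)) := (D.isOpen_tubeSet hG).prod isOpen_univ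
    have hev : D.collar jA jB =ᶠ[𝓝 p] fun p ↦ D.fP (D.tube.toHomeo.symm (D.tube.invA jA p.1), p.2) := by
      filter_upwards [hopen.mem_nhds ⟨hp, mem_univ _⟩] with p' hp'
      exact D.collar_eq_fP_of_mem_tubeSet hG hp'.1
    refine ContMDiffAt.congr_of_eventuallyEq ?_ hev
    have hco : ContMDiffOn (𝓡 3) ((𝓡 1).prod 𝓘(ℝ, 𝔼 2)) ∞ (fun y ↦ D.tube.toHomeo.symm (D.tube.invA jA y)) (D.tubeSet jA) := by
      refine D.tube.contMDiffOn_toHomeo_symm.comp ((D.tube.contMDiffOn_invA hG).mono (image_subset_range _ _)) ?_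
      rintro _ ⟨a, ha, rfl⟩
      show D.tube.invA jA (jA a) ∈ range D.tube.toFun
      rw [D.tube.invA_apply hG]; exact image_subset_range _ _ ha
    have hco' : ContMDiffAt ((𝓡 3).prod 𝓘(ℝ, ℝ)) (((𝓡 1).prod 𝓘(ℝ, 𝔼 2)).prod 𝓘(ℝ, ℝ)) ∞
        (fun p : Y × ℝ ↦ (D.tube.toHomeo.symm (D.tube.invA jA p.1), p.2)) p :=
      ((hco.contMDiffAt ((D.isOpen_tubeSet hG).mem_nhds hp)).comp p contMDiffAt_fst).prodMk contMDiffAt_snd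
    obtain ⟨a, ha, hpa⟩ := hp
    obtain ⟨⟨u, w⟩, huw, hq⟩ := ha
    have hw : w ≠ 0 ∧ ‖w‖ < 2 := by
      simp only [mem_prod, mem_univ, true_and, mem_sdiff, mem_ball, dist_zero_right, mem_singleton_iff] at huw
      exact ⟨huw.2, huw.1⟩
    have hmem : (D.tube.toHomeo.symm (D.tube.invA jA p.1), p.2) ∈ (fPdom : Set (((𝕊 1) × (𝔼 2)) × ℝ)) := by
      rw [← hpa, D.tube.invA_apply hG, ← hq, D.tube.toHomeo_symm_apply]
      exact hw
    have hfP := D.contMDiffOn_fP.contMDiffAt (isOpen_fPdom.mem_nhds hmem)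
    exact ContMDiffAt.comp (g := D.fP) (f := fun p : Y × ℝ ↦ (D.tube.toHomeo.symm (D.tube.invA jA p.1), p.2)) p hfP hco'
  · -- radial part
    have hopen : IsOpen ((D.radSet jA) ×ˢ (univ : Set ℝ)) := (D.isOpen_radSet hG).prod isOpen_univ
    have hev : D.collar jA jB =ᶠ[𝓝 p] fun p ↦ D.fR (D.tube.invA jA p.1, p.2) := by
      filter_upwards [hopen.mem_nhds ⟨hp, mem_univ _⟩] with p' hp'
      exact D.collar_eq_fR_of_mem_radSet hG hp'.1
    refine ContMDiffAt.congr_of_eventuallyEq ?_ hev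
    have hco : ContMDiffAt ((𝓡 3).prod 𝓘(ℝ, ℝ)) ((𝓡 3).prod 𝓘(ℝ, ℝ)) ∞ (fun p : Y × ℝ ↦ (D.tube.invA jA p.1, p.2)) p :=
      (((D.tube.contMDiffOn_invA hG).contMDiffAt (hG.2.1.mem_nhds (D.radSet_subset_range jA hp))).comp p
        contMDiffAt_fst).prodMk contMDiffAt_snd
    exact ContMDiffAt.comp (g := D.fR) (f := fun p : Y × ℝ ↦ (D.tube.invA jA p.1, p.2)) p D.contMDiff_fR.contMDiffAt hco
  · -- flat part
    have hmem : p.1 ∈ D.flatSetY jB := D.mem_flatSetY_of_not_mem_range hG hp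
    have hopen : IsOpen ((D.flatSetY jB) ×ˢ (univ : Set ℝ)) := (D.isOpen_flatSetY hG).prod isOpen_univ
    have hev : D.collar jA jB =ᶠ[𝓝 p] fun p ↦ D.fF (TubeNbhd.invB jB p.1, p.2) := by
      filter_upwards [hopen.mem_nhds ⟨hmem, mem_univ _⟩] with p' hp'
      exact D.collar_eq_fF_of_mem_flatSetY hG hp'.1
    refine ContMDiffAt.congr_of_eventuallyEq ?_ hev
    have hrange : p.1 ∈ range jB := image_subset_range _ _ hmem
    have hco : ContMDiffAt ((𝓡 3).prod 𝓘(ℝ, ℝ)) ((𝓘(ℝ, 𝔼 2).prod (𝓡 1)).prod 𝓘(ℝ, ℝ)) ∞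
        (fun p : Y × ℝ ↦ (TubeNbhd.invB jB p.1, p.2)) p :=
      (((D.tube.contMDiffOn_invB hG).contMDiffAt (hG.2.2.2.1.mem_nhds hrange)).comp p contMDiffAt_fst).prodMk
        contMDiffAt_snd
    have hmem' : (TubeNbhd.invB jB p.1, p.2) ∈ {q : ((𝔼 2) × (𝕊 1)) × ℝ | ‖q.1.1‖ < 4⁻¹} := by
      obtain ⟨b, hb, hby⟩ := hmem
      show ‖(TubeNbhd.invB jB p.1).1‖ < 4⁻¹
      rw [← hby, TubeNbhd.invB_apply _ hG]
      have : ‖(b : (𝔼 2) × (𝕊 1)).1‖ < (1 - D.s₀) / 4 := hb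
      linarith [D.s₀_pos]
    have hfF := D.contMDiffOn_fF.contMDiffAt ((isOpen_lt (continuous_norm.comp (continuous_fst.comp continuous_fst))
      continuous_const).mem_nhds hmem')
    exact ContMDiffAt.comp (g := D.fF) (f := fun p : Y × ℝ ↦ (TubeNbhd.invB jB p.1, p.2)) p hfF hco

end SmoothCollar

/-! ### Smoothness of the inverse collar -/

section SmoothInv

variable {Y : Type*} [TopologicalSpace Y] [ChartedSpace (𝔼 3) Y]
  {jA : D.tube.complement → Y} {jB : ↥solidTorus → Y}

/-- The radial part of `Y` is open. [folklore] -/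
theorem isOpen_radSetT : IsOpen D.radSetT := by
  have h1 : IsOpen {z : 𝔼 4 | 1 - D.s₀ < ‖z‖} := isOpen_lt continuous_const continuous_norm
  have hc : ContinuousOn (radialProjection (spherePt 3)) {z : 𝔼 4 | 1 - D.s₀ < ‖z‖} :=
    (contMDiffOn_radialProjection (spherePt 3)).continuousOn.mono fun z hz ↦ by
      rintro rfl; simp only [mem_setOf_eq, norm_zero] at hz; linarith [D.s₀_lt_one]
  exact hc.isOpen_inter_preimage h1 D.isClosed_unitTube.isOpen_compl

/-- The radial inverse formula is smooth on the radial region inside the ball [folklore] -/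
theorem contMDiffAt_ΨRad (hG : D.tube.IsSurgeryWith jA jB) {z : 𝔼 4} (hz : z ∈ D.radSetT) (hz1 : ‖z‖ < 1) :
    ContMDiffAt 𝓘(ℝ, 𝔼 4) ((𝓡 3).prod 𝓘(ℝ, ℝ)) ∞ (D.ΨRad jA) z := by
  obtain ⟨hzn, hdir⟩ := hz
  have hz0 : z ≠ 0 := by rintro rfl; simp at hzn; linarith [D.s₀_lt_one]
  have hc : radialProjection (spherePt 3) z ∉ range (K : 𝕊 1 → 𝕊 3) := fun h ↦ hdir (D.range_subset_unitTube h)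
  have h1 : ContMDiffAt 𝓘(ℝ, 𝔼 4) (𝓡 3) ∞ (fun y : 𝔼 4 ↦ D.tube.jAt jA (radialProjection (spherePt 3) y)) z :=
    ((D.tube.contMDiffOn_jAt hG).contMDiffAt (D.tube.complement.isOpen.mem_nhds hc)).comp z
      (TubeNbhd.contMDiffAt_radialProjection3 hz0)
  have h2 : ContDiffAt ℝ ∞ (fun y : 𝔼 4 ↦ -Real.log (SliceCollar.E D.s₀ (1 - ‖y‖))) z := by
    have hn : ContDiffAt ℝ ∞ (fun y : 𝔼 4 ↦ 1 - ‖y‖) z := contDiffAt_const.sub (contDiffAt_norm ℝ hz0)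
    have hE : ContDiffAt ℝ ∞ (fun y : 𝔼 4 ↦ SliceCollar.E D.s₀ (1 - ‖y‖)) z :=
      ContDiffAt.comp (g := SliceCollar.E D.s₀) (f := fun y : 𝔼 4 ↦ 1 - ‖y‖) z (SliceCollar.contDiffAt_E D.s₀ (by linarith)) hn
    exact (hE.log (SliceCollar.E_pos D.s₀_pos (by linarith) (by linarith)).ne').neg
  exact h1.prodMk h2.contMDiffAt

/-- The tube-regime set of the handle coordinates [folklore] -/
def Pset : Set ((𝔼 2) × (𝔼 2)) := {q | q ∈ (dom : Set ((𝔼 2) × (𝔼 2))) ∧ q.1 ≠ 0 ∧ q.2 ≠ 0 ∧ (1 - ‖q.1‖, ‖q.2‖) ∈ SliceCollar.P D.s₀}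

/-- The tube-regime set is open. [folklore] -/
theorem isOpen_Pset : IsOpen D.Pset := by
  have h1 : IsOpen {q : (𝔼 2) × (𝔼 2) | q.1 ≠ 0} := isOpen_ne.preimage continuous_fst
  have h2 : IsOpen {q : (𝔼 2) × (𝔼 2) | q.2 ≠ 0} := isOpen_ne.preimage continuous_snd
  have h3 : IsOpen {q : (𝔼 2) × (𝔼 2) | (1 - ‖q.1‖, ‖q.2‖) ∈ SliceCollar.P D.s₀} :=
    (SliceCollar.isOpen_P D.s₀).preimage ((continuous_const.sub (continuous_norm.comp continuous_fst)).prodMk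
      (continuous_norm.comp continuous_snd))
  have heq : D.Pset = (((dom : Set ((𝔼 2) × (𝔼 2))) ∩ {q | q.1 ≠ 0}) ∩ {q | q.2 ≠ 0}) ∩
      {q : (𝔼 2) × (𝔼 2) | (1 - ‖q.1‖, ‖q.2‖) ∈ SliceCollar.P D.s₀} := by
    ext q; simp only [Pset, mem_inter_iff, mem_setOf_eq, and_assoc]
  rw [heq]
  exact ((isOpen_dom.inter h1).inter h2).inter h3

/-- A point of `G(Pset)` in the radial region is a shallow cone point with normal radius `≥ 1` [folklore] -/
theorem shallow_of_mem_radSetT {q : (𝔼 2) × (𝔼 2)} (hq : q ∈ (dom : Set ((𝔼 2) × (𝔼 2)))) (hz : D.G q ∈ D.radSetT) :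
    1 - D.s₀ < ‖q.1‖ ∧ 1 < ‖q.2‖ := by
  obtain ⟨hzn, hdir⟩ := hz
  obtain ⟨h1, h2⟩ := mem_dom_iff.1 hq
  have hx : 1 - D.s₀ < ‖q.1‖ := by
    by_contra h
    have := D.deep q.1 q.2 (not_lt.1 h) h2
    exact absurd hzn (not_lt.2 this)
  refine ⟨hx, ?_⟩
  by_contra hw
  rw [not_lt] at hw
  have hxpos : 0 < ‖q.1‖ := by linarith [D.s₀_lt_one]
  have hz : D.G q = ‖q.1‖ • ((D.tube.toFun (radialProjection (spherePt 1) q.1, q.2) : 𝕊 3) : 𝔼 4) :=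
    D.G_eq_smul (by linarith [D.s₀_lt]) h1 h2
  apply hdir
  rw [show D.G q = D.G (q.1, q.2) from rfl, hz, radialProjection_smul _ hxpos, mem_unitTube_iff]
  exact hw

omit [TopologicalSpace Y] [ChartedSpace (𝔼 3) Y] in
/-- On `G(Pset)` the inverse collar is the tube inverse formula [folklore] -/
theorem collarInv_eq_ΨTube_of_mem {q : (𝔼 2) × (𝔼 2)} (hq : q ∈ D.Pset) : D.collarInv jA jB (D.G q) = D.ΨTube jA (D.G q) := by
  obtain ⟨hqd, hx, -, -⟩ := hq
  by_cases hz : D.G q ∈ D.radSetT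
  · rw [D.collarInv_of_mem_radSetT hz]
    obtain ⟨hx1, hw1⟩ := D.shallow_of_mem_radSetT hqd hz
    exact D.ΨRad_eq_ΨTube jA hx1 (mem_dom_iff.1 hqd).1 hw1.le (mem_dom_iff.1 hqd).2
  · exact D.collarInv_of_fst_ne_zero hz (by rw [D.Ginv_apply hqd]; exact hx)

/-- The tube inverse formula is smooth on `G(Pset)` [folklore] -/
theorem contMDiffAt_ΨTube (hG : D.tube.IsSurgeryWith jA jB) {q : (𝔼 2) × (𝔼 2)} (hq : q ∈ D.Pset) :
    ContMDiffAt 𝓘(ℝ, 𝔼 4) ((𝓡 3).prod 𝓘(ℝ, ℝ)) ∞ (D.ΨTube jA) (D.G q) := by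
  haveI : Fact (Module.finrank ℝ (𝔼 2) = 1 + 1) := ⟨by simp⟩
  obtain ⟨hqd, hx, hw, hP⟩ := hq
  have hN : D.G q ∈ D.N := ⟨q, hqd, rfl⟩
  have hGinv : D.Ginv (D.G q) = q := D.Ginv_apply hqd
  -- the handle coordinates are smooth
  have hxco : ContMDiffAt 𝓘(ℝ, 𝔼 4) 𝓘(ℝ, 𝔼 2) ∞ (fun z ↦ (D.Ginv z).1) (D.G q) :=
    (contDiffAt_fst.comp _ (D.contDiffAt_Ginv hN)).contMDiffAt
  have hwco : ContMDiffAt 𝓘(ℝ, 𝔼 4) 𝓘(ℝ, 𝔼 2) ∞ (fun z ↦ (D.Ginv z).2) (D.G q) :=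
    (contDiffAt_snd.comp _ (D.contDiffAt_Ginv hN)).contMDiffAt
  -- the profile values
  have hprof : ContMDiffAt 𝓘(ℝ, 𝔼 4) 𝓘(ℝ, ℝ × ℝ) ∞ D.profB (D.G q) := by
    have hargs : ContMDiffAt 𝓘(ℝ, 𝔼 4) 𝓘(ℝ, ℝ × ℝ) ∞ (fun z ↦ (1 - ‖(D.Ginv z).1‖, ‖(D.Ginv z).2‖)) (D.G q) := by
      have h1 : ContMDiffAt 𝓘(ℝ, 𝔼 4) 𝓘(ℝ, ℝ) ∞ (fun z ↦ 1 - ‖(D.Ginv z).1‖) (D.G q) := by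
        have : ContDiffAt ℝ ∞ (fun x : 𝔼 2 ↦ 1 - ‖x‖) (D.Ginv (D.G q)).1 := contDiffAt_const.sub (contDiffAt_norm ℝ (by rw [hGinv]; exact hx))
        exact ContMDiffAt.comp (g := fun x : 𝔼 2 ↦ 1 - ‖x‖) (f := fun z ↦ (D.Ginv z).1) (D.G q) this.contMDiffAt hxco
      have h2 : ContMDiffAt 𝓘(ℝ, 𝔼 4) 𝓘(ℝ, ℝ) ∞ (fun z ↦ ‖(D.Ginv z).2‖) (D.G q) :=
        ContMDiffAt.comp (g := fun w : 𝔼 2 ↦ ‖w‖) (f := fun z ↦ (D.Ginv z).2) (D.G q)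
          (contDiffAt_norm ℝ (by rw [hGinv]; exact hw)).contMDiffAt hwco
      exact h1.prodMk_space h2
    have hΨ : ContDiffAt ℝ ∞ (SliceCollar.Ψ D.s₀) (1 - ‖(D.Ginv (D.G q)).1‖, ‖(D.Ginv (D.G q)).2‖) := by
      rw [hGinv]; exact SliceCollar.contDiffAt_Ψ D.s₀_pos hP
    exact ContMDiffAt.comp (g := SliceCollar.Ψ D.s₀) (f := fun z ↦ (1 - ‖(D.Ginv z).1‖, ‖(D.Ginv z).2‖)) _ hΨ.contMDiffAt hargs
  have hτpos : 0 < (D.profB (D.G q)).1 := by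
    rw [profB, hGinv]; exact (SliceCollar.Ψ_mem_Strip hP).1.1
  -- second component
  have h2 : ContMDiffAt 𝓘(ℝ, 𝔼 4) 𝓘(ℝ, ℝ) ∞ (fun z ↦ (D.profB z).2) (D.G q) :=
    ContMDiffAt.comp (g := fun r : ℝ × ℝ ↦ r.2) (f := D.profB) _ contDiffAt_snd.contMDiffAt hprof
  -- first component `jAt (ν (x̂, τ • ŵ))`
  have hτ : ContMDiffAt 𝓘(ℝ, 𝔼 4) 𝓘(ℝ, ℝ) ∞ (fun z ↦ (D.profB z).1) (D.G q) :=
    ContMDiffAt.comp (g := fun r : ℝ × ℝ ↦ r.1) (f := D.profB) _ contDiffAt_fst.contMDiffAt hprof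
  have hu : ContMDiffAt 𝓘(ℝ, 𝔼 4) (𝓡 1) ∞ (fun z ↦ radialProjection (spherePt 1) (D.Ginv z).1) (D.G q) :=
    ContMDiffAt.comp (g := radialProjection (spherePt 1)) (f := fun z ↦ (D.Ginv z).1) (D.G q)
      ((contMDiffOn_radialProjection (spherePt 1)).contMDiffAt (isOpen_ne.mem_nhds (by rw [hGinv]; exact hx))) hxco
  have hv' : ContMDiffAt 𝓘(ℝ, 𝔼 4) (𝓡 1) ∞ (fun z ↦ radialProjection (spherePt 1) (D.Ginv z).2) (D.G q) :=
    ContMDiffAt.comp (g := radialProjection (spherePt 1)) (f := fun z ↦ (D.Ginv z).2) (D.G q)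
      ((contMDiffOn_radialProjection (spherePt 1)).contMDiffAt (isOpen_ne.mem_nhds (by rw [hGinv]; exact hw))) hwco
  have hv : ContMDiffAt 𝓘(ℝ, 𝔼 4) 𝓘(ℝ, 𝔼 2) ∞ (fun z ↦ ((radialProjection (spherePt 1) (D.Ginv z).2 : 𝕊 1) : 𝔼 2)) (D.G q) :=
    (contMDiff_coe_sphere (E := 𝔼 2) (n := 1)).contMDiffAt.comp (D.G q) hv'
  have hfib : ContMDiffAt 𝓘(ℝ, 𝔼 4) 𝓘(ℝ, 𝔼 2) ∞
      (fun z ↦ (D.profB z).1 • ((radialProjection (spherePt 1) (D.Ginv z).2 : 𝕊 1) : 𝔼 2)) (D.G q) :=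
    (TubeNbhd.contDiff_smul_pair (𝔼 2)).contMDiff.contMDiffAt.comp _ (hτ.prodMk_space hv)
  have hpt : ContMDiffAt 𝓘(ℝ, 𝔼 4) (𝓡 3) ∞
      (fun z ↦ D.tube.toFun (radialProjection (spherePt 1) (D.Ginv z).1,
        (D.profB z).1 • ((radialProjection (spherePt 1) (D.Ginv z).2 : 𝕊 1) : 𝔼 2))) (D.G q) :=
    D.tube.contMDiff.contMDiffAt.comp (D.G q) (hu.prodMk hfib)
  have hmem : D.tube.toFun (radialProjection (spherePt 1) (D.Ginv (D.G q)).1,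
      (D.profB (D.G q)).1 • ((radialProjection (spherePt 1) (D.Ginv (D.G q)).2 : 𝕊 1) : 𝔼 2)) ∈ D.tube.complement :=
    D.tube.apply_smul_not_mem_range hτpos.ne' _ _
  have h1 : ContMDiffAt 𝓘(ℝ, 𝔼 4) (𝓡 3) ∞ (fun z ↦ D.tube.ptY jA (D.profB z).1 (radialProjection (spherePt 1) (D.Ginv z).1)
      (radialProjection (spherePt 1) (D.Ginv z).2)) (D.G q) :=
    ContMDiffAt.comp (g := D.tube.jAt jA) (f := fun z ↦ D.tube.toFun (radialProjection (spherePt 1) (D.Ginv z).1,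
        (D.profB z).1 • ((radialProjection (spherePt 1) (D.Ginv z).2 : 𝕊 1) : 𝔼 2))) (D.G q)
      ((D.tube.contMDiffOn_jAt hG).contMDiffAt (D.tube.complement.isOpen.mem_nhds hmem)) hpt
  exact h1.prodMk h2

/-- The flat-regime set of the handle coordinates [folklore] -/
def Fset : Set ((𝔼 2) × (𝔼 2)) := {q | ‖q.1‖ < 1 - D.s₀ ∧ q.2 ≠ 0 ∧ ‖q.2‖ < 1}

/-- The flat-regime set is open. [folklore] -/
theorem isOpen_Fset : IsOpen D.Fset := by
  have h1 : IsOpen {q : (𝔼 2) × (𝔼 2) | ‖q.1‖ < 1 - D.s₀} := isOpen_lt (continuous_norm.comp continuous_fst) continuous_const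
  have h2 : IsOpen {q : (𝔼 2) × (𝔼 2) | q.2 ≠ 0} := isOpen_ne.preimage continuous_snd
  have h3 : IsOpen {q : (𝔼 2) × (𝔼 2) | ‖q.2‖ < 1} := isOpen_lt (continuous_norm.comp continuous_snd) continuous_const
  have heq : D.Fset = ({q : (𝔼 2) × (𝔼 2) | ‖q.1‖ < 1 - D.s₀} ∩ {q | q.2 ≠ 0}) ∩ {q | ‖q.2‖ < 1} := by
    ext q; simp only [Fset, mem_inter_iff, mem_setOf_eq, and_assoc]
  rw [heq]; exact (h1.inter h2).inter h3

/-- The flat-regime set lies in the domain of the disc tube. [folklore] -/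
theorem Fset_subset_dom : D.Fset ⊆ dom := fun q hq ↦ mem_dom_iff.2 ⟨by linarith [hq.1, D.s₀_pos], hq.2.2.trans one_lt_two⟩

/-- On `G(Fset)` the inverse collar is the flat inverse formula [folklore] -/
theorem collarInv_eq_ΨFlat_of_mem (hG : D.tube.IsSurgeryWith jA jB) {q : (𝔼 2) × (𝔼 2)} (hq : q ∈ D.Fset) :
    D.collarInv jA jB (D.G q) = D.ΨFlat jB (D.G q) := by
  obtain ⟨hx1, hw, hw1⟩ := hq
  have hqd := D.Fset_subset_dom ⟨hx1, hw, hw1⟩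
  have hz : D.G q ∉ D.radSetT := D.not_mem_radSetT_of_norm_le (D.deep q.1 q.2 hx1.le (by linarith))
  by_cases hx : q.1 = 0
  · exact D.collarInv_of_fst_eq_zero hz (by rw [D.Ginv_apply hqd]; exact hx)
  · rw [D.collarInv_of_fst_ne_zero hz (by rw [D.Ginv_apply hqd]; exact hx)]
    rw [show D.G q = D.G (q.1, q.2) from rfl]
    exact D.ΨTube_eq_ΨFlat hG hx hx1.le hw hw1

/-- The flat inverse formula is smooth on `G(Fset)` [folklore] -/
theorem contMDiffAt_ΨFlat (hG : D.tube.IsSurgeryWith jA jB) {q : (𝔼 2) × (𝔼 2)} (hq : q ∈ D.Fset) :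
    ContMDiffAt 𝓘(ℝ, 𝔼 4) ((𝓡 3).prod 𝓘(ℝ, ℝ)) ∞ (D.ΨFlat jB) (D.G q) := by
  haveI : Fact (Module.finrank ℝ (𝔼 2) = 1 + 1) := ⟨by simp⟩
  obtain ⟨hx1, hw, hw1⟩ := hq
  have hqd := D.Fset_subset_dom ⟨hx1, hw, hw1⟩
  have hN : D.G q ∈ D.N := ⟨q, hqd, rfl⟩
  have hGinv : D.Ginv (D.G q) = q := D.Ginv_apply hqd
  have hwpos : 0 < ‖q.2‖ := norm_pos_iff.2 hw
  have hxco : ContMDiffAt 𝓘(ℝ, 𝔼 4) 𝓘(ℝ, 𝔼 2) ∞ (fun z ↦ (D.Ginv z).1) (D.G q) :=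
    (contDiffAt_fst.comp _ (D.contDiffAt_Ginv hN)).contMDiffAt
  have hwco : ContMDiffAt 𝓘(ℝ, 𝔼 4) 𝓘(ℝ, 𝔼 2) ∞ (fun z ↦ (D.Ginv z).2) (D.G q) :=
    (contDiffAt_snd.comp _ (D.contDiffAt_Ginv hN)).contMDiffAt
  -- first component `jBt (x/4, ŵ)`
  have hp : ContMDiffAt 𝓘(ℝ, 𝔼 4) 𝓘(ℝ, 𝔼 2) ∞ (fun z ↦ (4 : ℝ)⁻¹ • (D.Ginv z).1) (D.G q) :=
    ContMDiffAt.comp (g := fun x : 𝔼 2 ↦ (4 : ℝ)⁻¹ • x) (f := fun z ↦ (D.Ginv z).1) (D.G q)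
      (contDiff_const_smul (4 : ℝ)⁻¹).contDiffAt.contMDiffAt hxco
  have hv : ContMDiffAt 𝓘(ℝ, 𝔼 4) (𝓡 1) ∞ (fun z ↦ radialProjection (spherePt 1) (D.Ginv z).2) (D.G q) :=
    ContMDiffAt.comp (g := radialProjection (spherePt 1)) (f := fun z ↦ (D.Ginv z).2) (D.G q)
      ((contMDiffOn_radialProjection (spherePt 1)).contMDiffAt (isOpen_ne.mem_nhds (by rw [hGinv]; exact hw))) hwco
  have hpt : ContMDiffAt 𝓘(ℝ, 𝔼 4) (𝓘(ℝ, 𝔼 2).prod (𝓡 1)) ∞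
      (fun z ↦ (((4 : ℝ)⁻¹ • (D.Ginv z).1, radialProjection (spherePt 1) (D.Ginv z).2) : (𝔼 2) × (𝕊 1))) (D.G q) :=
    hp.prodMk hv
  have hmem : ((((4 : ℝ)⁻¹ • (D.Ginv (D.G q)).1, radialProjection (spherePt 1) (D.Ginv (D.G q)).2)) : (𝔼 2) × (𝕊 1)) ∈ solidTorus := by
    rw [mem_solidTorus_iff, hGinv]
    simp only
    rw [norm_smul, Real.norm_of_nonneg (by norm_num : (0 : ℝ) ≤ 4⁻¹)]
    linarith [D.s₀_pos]
  have h1 : ContMDiffAt 𝓘(ℝ, 𝔼 4) (𝓡 3) ∞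
      (fun z ↦ TubeNbhd.jBt jB ((4 : ℝ)⁻¹ • (D.Ginv z).1, radialProjection (spherePt 1) (D.Ginv z).2)) (D.G q) :=
    ContMDiffAt.comp (g := TubeNbhd.jBt jB) _ ((D.tube.contMDiffOn_jBt hG).contMDiffAt (solidTorus.isOpen.mem_nhds hmem)) hpt
  -- second component
  have h2 : ContMDiffAt 𝓘(ℝ, 𝔼 4) 𝓘(ℝ, ℝ) ∞ (fun z ↦ -Real.log (SliceCollar.E 1 ‖(D.Ginv z).2‖)) (D.G q) := by
    have hE : ContDiffAt ℝ ∞ (fun w : 𝔼 2 ↦ -Real.log (SliceCollar.E 1 ‖w‖)) (D.Ginv (D.G q)).2 := by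
      rw [hGinv]
      have hn : ContDiffAt ℝ ∞ (fun w : 𝔼 2 ↦ ‖w‖) q.2 := contDiffAt_norm ℝ hw
      have hE' : ContDiffAt ℝ ∞ (fun w : 𝔼 2 ↦ SliceCollar.E 1 ‖w‖) q.2 :=
        ContDiffAt.comp (g := SliceCollar.E 1) (f := fun w : 𝔼 2 ↦ ‖w‖) q.2 (SliceCollar.contDiffAt_E 1 hwpos) hn
      exact (hE'.log (SliceCollar.E_pos one_pos hwpos hw1).ne').neg
    exact ContMDiffAt.comp (g := fun w : 𝔼 2 ↦ -Real.log (SliceCollar.E 1 ‖w‖)) (f := fun z ↦ (D.Ginv z).2) (D.G q)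
      hE.contMDiffAt hwco
  exact h1.prodMk h2

/-- **the inverse collar is smooth on the collar region** [folklore] -/
theorem contMDiffOn_collarInv (hG : D.tube.IsSurgeryWith jA jB) :
    ContMDiffOn 𝓘(ℝ, 𝔼 4) ((𝓡 3).prod 𝓘(ℝ, ℝ)) ∞ (D.collarInv jA jB) D.region := by
  intro z hz
  refine ContMDiffAt.contMDiffWithinAt ?_
  by_cases hrad : z ∈ D.radSetT
  · have hev : D.collarInv jA jB =ᶠ[𝓝 z] D.ΨRad jA := by
      filter_upwards [D.isOpen_radSetT.mem_nhds hrad] with z' hz'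
      exact D.collarInv_of_mem_radSetT hz'
    exact (D.contMDiffAt_ΨRad hG hrad hz.1).congr_of_eventuallyEq hev
  · have hN := D.mem_N_of_region hz hrad
    have hq := D.Ginv_mem hN
    have hGz := D.G_Ginv hN
    have hw : (D.Ginv z).2 ≠ 0 := D.snd_ne_zero_of_not_mem_disc hq (by rw [hGz]; exact hz.2.1)
    by_cases hx : (D.Ginv z).1 = 0
    · -- flat regime
      have hw1 : ‖(D.Ginv z).2‖ < 1 := D.norm_snd_lt_one hq (by rw [hGz]; exact hz.2.2) (by rw [hx]; simp; linarith [D.s₀_lt_one])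
      have hF : D.Ginv z ∈ D.Fset := ⟨by rw [hx]; simp; linarith [D.s₀_lt_one], hw, hw1⟩
      have hev : D.collarInv jA jB =ᶠ[𝓝 z] D.ΨFlat jB := by
        have ho : IsOpen (D.G '' D.Fset) := D.isOpen_image D.isOpen_Fset D.Fset_subset_dom
        filter_upwards [ho.mem_nhds ⟨_, hF, hGz⟩] with z' hz'
        obtain ⟨q', hq', rfl⟩ := hz'
        exact D.collarInv_eq_ΨFlat_of_mem hG hq'
      have := D.contMDiffAt_ΨFlat hG hF
      rw [hGz] at this
      exact this.congr_of_eventuallyEq hev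
    · -- tube regime
      have hP : D.Ginv z ∈ D.Pset :=
        ⟨hq, hx, hw, D.mem_P_of_region hq hx (by rw [hGz]; exact hz.2.1) (by rw [hGz]; exact hz.2.2)⟩
      have hev : D.collarInv jA jB =ᶠ[𝓝 z] D.ΨTube jA := by
        have ho : IsOpen (D.G '' D.Pset) := D.isOpen_image D.isOpen_Pset fun q hq ↦ hq.1
        filter_upwards [ho.mem_nhds ⟨_, hP, hGz⟩] with z' hz'
        obtain ⟨q', hq', rfl⟩ := hz'
        exact D.collarInv_eq_ΨTube_of_mem hq'
      have := D.contMDiffAt_ΨTube hG hP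
      rw [hGz] at this
      exact this.congr_of_eventuallyEq hev

end SmoothInv

/-! ### The size function `M = E_{s₀}(1 - ‖z‖) + E_1(‖w‖)` and its continuity on the exterior -/

section Size

variable {Y : Type*} [TopologicalSpace Y] [ChartedSpace (𝔼 3) Y]
  {jA : D.tube.complement → Y} {jB : ↥solidTorus → Y}

/-- **the exterior** `O = B̊⁴ ∖ Δ` [folklore] -/
def O : Set (𝔼 4) := {z | ‖z‖ < 1 ∧ z ∉ D.disc}

/-- The exterior is open. [folklore] -/
theorem isOpen_O : IsOpen D.O := by
  have : D.O = ball (0 : 𝔼 4) 1 ∩ D.discᶜ := by ext z; simp [O, mem_ball, dist_zero_right]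
  rw [this]; exact isOpen_ball.inter D.isClosed_disc.isOpen_compl

/-- The collar region lies in the exterior. [folklore] -/
theorem region_subset_O : D.region ⊆ D.O := fun _ hz ↦ ⟨hz.1, hz.2.1⟩

/-- The core lies in the exterior [folklore] -/
theorem core_subset_O : D.core ⊆ D.O := by
  rintro z ⟨hz, hzG⟩
  rw [mem_closedBall, dist_zero_right] at hz
  refine ⟨by linarith [D.s₀_pos], fun hd ↦ ?_⟩
  obtain ⟨x, hx, rfl⟩ := hd
  rw [mem_closedBall, dist_zero_right] at hx
  rcases hx.lt_or_eq with hlt | heq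
  · rcases le_or_gt ‖x‖ (1 - D.s₀) with hle | hgt
    · exact hzG ⟨(x, 0), ⟨by simpa using hlt, by simp⟩, D.apply_zero x (by simpa using hlt)⟩
    · have hx0 : x ≠ 0 := by rintro rfl; simp at hgt; linarith [D.s₀_lt_one]
      have : D.g x = ‖x‖ • ((K (radialProjection (spherePt 1) x) : 𝕊 3) : 𝔼 4) := by
        conv_lhs => rw [← norm_smul_coe_radialProjection (spherePt 1) x]
        exact D.g_cone _ _ (by linarith [D.s₀_lt]) hx
      rw [this, norm_smul_coe_sphere (norm_nonneg _)] at hz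
      linarith
  · have := D.norm_g_of_norm_eq_one heq
    linarith [D.s₀_pos]

/-- **the exterior is the collar region together with the core** [folklore] -/
theorem O_eq : D.O = D.region ∪ D.core := by
  refine Subset.antisymm (fun z hz ↦ ?_) (union_subset D.region_subset_O D.core_subset_O)
  by_cases hc : z ∈ D.core
  · exact Or.inr hc
  · exact Or.inl ⟨hz.1, hz.2, hc⟩

open Classical in
/-- The normal-radius part of the size: `E_1 (‖w‖)` at `G (x, w)`, `0` off the tube [folklore] -/
def χ (z : 𝔼 4) : ℝ := if z ∈ D.N then SliceCollar.E 1 ‖(D.Ginv z).2‖ else 0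

/-- **the size function** `M = E_{s₀}(1 - ‖z‖) + χ` (`= e^{-σ}` on the collar region, `= 0` on the core) [folklore] -/
def M (z : 𝔼 4) : ℝ := SliceCollar.E D.s₀ (1 - ‖z‖) + D.χ z

/-- The normal-radius size in the tube. [folklore] -/
theorem χ_of_mem {z : 𝔼 4} (hz : z ∈ D.N) : D.χ z = SliceCollar.E 1 ‖(D.Ginv z).2‖ := if_pos hz

/-- The normal-radius size off the tube vanishes. [folklore] -/
theorem χ_of_not_mem {z : 𝔼 4} (hz : z ∉ D.N) : D.χ z = 0 := if_neg hz

/-- The normal-radius size is nonnegative. [folklore] -/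
theorem χ_nonneg (z : 𝔼 4) : 0 ≤ D.χ z := by
  by_cases hz : z ∈ D.N
  · rw [D.χ_of_mem hz]; exact SliceCollar.E_nonneg _ _
  · rw [D.χ_of_not_mem hz]

/-- Off the tube near a point of the exterior outside the tube the normal radius is `≥ 1`:
tube points converging to a point of the exterior not in the tube leave the part `‖w‖ < 1` of the tube [folklore] -/
theorem eventually_one_le_norm_snd {z : 𝔼 4} (hz : z ∈ D.O) (hzN : z ∉ D.N) :
    ∀ᶠ z' in 𝓝 z, z' ∈ D.N → 1 ≤ ‖(D.Ginv z').2‖ := by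
  -- argue by contradiction with a sequence in the compact part `‖x‖ ≤ c`, `‖w‖ ≤ 1` of the domain
  by_contra hcon
  have hfreq : ∃ᶠ z' in 𝓝 z, z' ∈ D.N ∧ ‖(D.Ginv z').2‖ < 1 := by
    rw [Filter.not_eventually] at hcon
    exact hcon.mono fun z' h ↦ by push Not at h; exact h
  have hmem : z ∈ closure {z' | z' ∈ D.N ∧ ‖(D.Ginv z').2‖ < 1} := by
    rw [mem_closure_iff_frequently]; exact hfreq
  obtain ⟨u, hu, hlim⟩ := mem_closure_iff_seq_limit.1 hmem
  -- the handle coordinates of the sequence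
  set c : ℝ := max (1 - D.s₁) ((1 + ‖z‖) / 2) with hc
  have hc1 : c < 1 := max_lt (by linarith [D.s₁_pos]) (by linarith [hz.1])
  have hKd : closedBall (0 : 𝔼 2) c ×ˢ closedBall (0 : 𝔼 2) 1 ⊆ (dom : Set ((𝔼 2) × (𝔼 2))) := by
    intro q hq
    rw [mem_prod, mem_closedBall, mem_closedBall, dist_zero_right, dist_zero_right] at hq
    exact mem_dom_iff.2 ⟨hq.1.trans_lt hc1, hq.2.trans_lt one_lt_two⟩
  have hnorm : ∀ᶠ n in Filter.atTop, ‖u n‖ < (1 + ‖z‖) / 2 :=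
    (continuous_norm.tendsto z |>.comp hlim).eventually (gt_mem_nhds (by linarith [hz.1]))
  have hev : ∀ᶠ n in Filter.atTop, D.Ginv (u n) ∈ closedBall (0 : 𝔼 2) c ×ˢ closedBall (0 : 𝔼 2) 1 := by
    filter_upwards [hnorm] with n hn
    obtain ⟨hN, hw⟩ := hu n
    have hq := D.Ginv_mem hN
    have hGz := D.G_Ginv hN
    obtain ⟨hx1, hw2⟩ := mem_dom_iff.1 hq
    refine ⟨?_, ?_⟩
    · rw [mem_closedBall, dist_zero_right]
      rcases le_or_gt ‖(D.Ginv (u n)).1‖ (1 - D.s₁) with h | h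
      · exact h.trans (le_max_left _ _)
      · -- a cone point: `‖z'‖ = ‖x'‖`
        have hz' : ‖u n‖ = ‖(D.Ginv (u n)).1‖ := by
          conv_lhs => rw [← hGz, show D.Ginv (u n) = ((D.Ginv (u n)).1, (D.Ginv (u n)).2) from rfl,
            D.G_eq_smul h hx1 hw2, norm_smul_coe_sphere (norm_nonneg _)]
        rw [← hz']; exact hn.le.trans (le_max_right _ _)
    · rw [mem_closedBall, dist_zero_right]; exact hw.le
  -- a convergent subsequence of the coordinates
  obtain ⟨q, hq, φ, hφ, hφlim⟩ := ((isCompact_closedBall _ _).prod (isCompact_closedBall _ _)).tendsto_subseq' hev.frequently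
  have hqd : q ∈ (dom : Set ((𝔼 2) × (𝔼 2))) := hKd hq
  have h1 : Filter.Tendsto (fun n ↦ D.G (D.Ginv (u (φ n)))) Filter.atTop (𝓝 (D.G q)) :=
    ((D.contDiffAt_G hqd).continuousAt.tendsto).comp hφlim
  have h2 : Filter.Tendsto (fun n ↦ D.G (D.Ginv (u (φ n)))) Filter.atTop (𝓝 z) := by
    have : (fun n ↦ D.G (D.Ginv (u (φ n)))) = u ∘ φ := funext fun n ↦ D.G_Ginv (hu (φ n)).1
    rw [this]; exact hlim.comp hφ.tendsto_atTop
  exact hzN (tendsto_nhds_unique h2 h1 ▸ ⟨q, hqd, rfl⟩)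

/-- **the normal-radius size is continuous on the exterior** [folklore] -/
theorem continuousOn_χ : ContinuousOn D.χ D.O := by
  intro z hz
  refine ContinuousAt.continuousWithinAt ?_
  by_cases hzN : z ∈ D.N
  · -- in the tube: locally `E_1 (‖w‖)` with `w ≠ 0`
    have hw : (D.Ginv z).2 ≠ 0 := D.snd_ne_zero_of_not_mem_disc (D.Ginv_mem hzN) (by rw [D.G_Ginv hzN]; exact hz.2)
    have hev : D.χ =ᶠ[𝓝 z] fun z' ↦ SliceCollar.E 1 ‖(D.Ginv z').2‖ := by
      filter_upwards [D.isOpen_N.mem_nhds hzN] with z' hz'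
      exact D.χ_of_mem hz'
    refine ContinuousAt.congr_of_eventuallyEq ?_ hev
    have hco : ContinuousAt (fun z' ↦ ‖(D.Ginv z').2‖) z :=
      (continuous_norm.comp continuous_snd).continuousAt.comp (D.contDiffAt_Ginv hzN).continuousAt
    exact ContinuousAt.comp (g := SliceCollar.E 1) (SliceCollar.contDiffAt_E 1 (norm_pos_iff.2 hw)).continuousAt hco
  · -- off the tube: locally `0`
    have hev : D.χ =ᶠ[𝓝 z] fun _ ↦ 0 := by
      filter_upwards [D.eventually_one_le_norm_snd hz hzN] with z' hz'
      by_cases h : z' ∈ D.N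
      · rw [D.χ_of_mem h, SliceCollar.E_of_le one_pos (by linarith [hz' h]) (hz' h)]
      · exact D.χ_of_not_mem h
    exact continuousAt_const.congr_of_eventuallyEq hev

/-- **the size function is continuous on the exterior** [folklore] -/
theorem continuousOn_M : ContinuousOn D.M D.O := by
  refine ContinuousOn.add ?_ D.continuousOn_χ
  intro z hz
  have h0 : 0 < 1 - ‖z‖ := by linarith [hz.1]
  have h1 : ContinuousAt (fun z' : 𝔼 4 ↦ 1 - ‖z'‖) z := (continuous_const.sub continuous_norm).continuousAt
  exact (ContinuousAt.comp (g := SliceCollar.E D.s₀) (f := fun z' : 𝔼 4 ↦ 1 - ‖z'‖) (x := z)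
    (SliceCollar.contDiffAt_E D.s₀ h0).continuousAt h1).continuousWithinAt

omit [TopologicalSpace Y] [ChartedSpace (𝔼 3) Y] in
/-- **on the collar region the size is `e^{-σ}`** [folklore] -/
theorem M_eq_exp (jA : D.tube.complement → Y) (jB : ↥solidTorus → Y) {z : 𝔼 4} (hz : z ∈ D.region) :
    D.M z = Real.exp (-(D.collarInv jA jB z).2) := by
  by_cases hrad : z ∈ D.radSetT
  · -- radial branch: `σ = -log E_{s₀}(1 - ‖z‖)` and `χ = 0`
    obtain ⟨hzn, hdir⟩ := hrad
    rw [D.collarInv_of_mem_radSetT ⟨hzn, hdir⟩, ΨRad]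
    simp only [neg_neg]
    rw [Real.exp_log (SliceCollar.E_pos D.s₀_pos (by linarith [hz.1]) (by linarith)), M]
    suffices hχ : D.χ z = 0 by rw [hχ, add_zero]
    by_cases hzN : z ∈ D.N
    · rw [D.χ_of_mem hzN]
      obtain ⟨-, hw1⟩ := D.shallow_of_mem_radSetT (D.Ginv_mem hzN) (by rw [D.G_Ginv hzN]; exact ⟨hzn, hdir⟩)
      exact SliceCollar.E_of_le one_pos (by linarith) hw1.le
    · exact D.χ_of_not_mem hzN
  · have hN := D.mem_N_of_region hz hrad
    have hq := D.Ginv_mem hN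
    have hGz := D.G_Ginv hN
    obtain ⟨hx1, hw2⟩ := mem_dom_iff.1 hq
    rw [M, D.χ_of_mem hN]
    -- the depth term: `E_{s₀}(1 - ‖z‖) = E_{s₀}(1 - ‖x‖)` (both vanish over the deep disc)
    have hdepth : SliceCollar.E D.s₀ (1 - ‖z‖) = SliceCollar.E D.s₀ (1 - ‖(D.Ginv z).1‖) := by
      rcases lt_or_ge (1 - D.s₁) ‖(D.Ginv z).1‖ with h | h
      · conv_lhs => rw [← hGz, show D.Ginv z = ((D.Ginv z).1, (D.Ginv z).2) from rfl, D.G_eq_smul h hx1 hw2,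
          norm_smul_coe_sphere (norm_nonneg _)]
      · have hz' : ‖z‖ ≤ 1 - D.s₀ := by
          have := D.deep (D.Ginv z).1 (D.Ginv z).2 (by linarith [D.s₀_lt]) hw2
          rwa [show ((D.Ginv z).1, (D.Ginv z).2) = D.Ginv z from rfl, hGz] at this
        rw [SliceCollar.E_of_le D.s₀_pos (by linarith [hz.1]) (by linarith),
          SliceCollar.E_of_le D.s₀_pos (by linarith) (by linarith [D.s₀_lt])]
    rw [hdepth]
    by_cases hx : (D.Ginv z).1 = 0
    · -- flat branch
      rw [D.collarInv_of_fst_eq_zero hrad hx, ΨFlat]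
      simp only [neg_neg]
      have hw : (D.Ginv z).2 ≠ 0 := D.snd_ne_zero_of_not_mem_disc hq (by rw [hGz]; exact hz.2.1)
      have hw1 : ‖(D.Ginv z).2‖ < 1 := D.norm_snd_lt_one hq (by rw [hGz]; exact hz.2.2) (by rw [hx]; simp; linarith [D.s₀_lt_one])
      rw [Real.exp_log (SliceCollar.E_pos one_pos (norm_pos_iff.2 hw) hw1), hx, norm_zero, sub_zero,
        SliceCollar.E_of_le D.s₀_pos one_pos D.s₀_lt_one.le, zero_add]
    · -- tube branch: `σ = h = -log F`
      have hP : (1 - ‖(D.Ginv z).1‖, ‖(D.Ginv z).2‖) ∈ SliceCollar.P D.s₀ :=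
        D.mem_P_of_region hq hx (by rw [hGz]; exact hz.2.1) (by rw [hGz]; exact hz.2.2)
      rw [D.collarInv_of_fst_ne_zero hrad hx, ΨTube, profB]
      simp only [SliceCollar.Ψ, SliceCollar.hgt, neg_neg]
      rw [Real.exp_log (SliceCollar.F_pos D.s₀_pos hP), SliceCollar.F]

/-- **on the core the size vanishes** [folklore] -/
theorem M_eq_zero_of_mem_core {z : 𝔼 4} (hz : z ∈ D.core) : D.M z = 0 := by
  obtain ⟨hzn, hzG⟩ := hz
  rw [mem_closedBall, dist_zero_right] at hzn
  rw [M, SliceCollar.E_of_le D.s₀_pos (by linarith [D.s₀_pos]) (by linarith), zero_add]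
  by_cases hzN : z ∈ D.N
  · rw [D.χ_of_mem hzN]
    have hq := D.Ginv_mem hzN
    obtain ⟨hx1, hw2⟩ := mem_dom_iff.1 hq
    refine SliceCollar.E_of_le one_pos ?_ ?_
    · -- `w ≠ 0`, for otherwise `z` is a disc point, which is not in the core
      refine norm_pos_iff.2 fun hw ↦ hzG ?_
      have hx : ‖(D.Ginv z).1‖ ≤ 1 - D.s₀ := by
        by_contra h
        rw [not_le] at h
        have := D.G_eq_smul (by linarith [D.s₀_lt]) hx1 hw2
        rw [show ((D.Ginv z).1, (D.Ginv z).2) = D.Ginv z from rfl, D.G_Ginv hzN] at this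
        rw [this, norm_smul_coe_sphere (norm_nonneg _)] at hzn
        linarith
      exact ⟨D.Ginv z, ⟨by rw [mem_ball, dist_zero_right]; linarith [D.s₀_pos], by
        rw [mem_ball, dist_zero_right, hw, norm_zero]; exact one_pos⟩, D.G_Ginv hzN⟩
    · by_contra hw
      rw [not_le] at hw
      refine hzG ⟨D.Ginv z, ⟨?_, by rwa [mem_ball, dist_zero_right]⟩, D.G_Ginv hzN⟩
      rw [mem_ball, dist_zero_right]
      by_contra h
      rw [not_lt] at h
      have hgt : 1 - D.s₁ < ‖(D.Ginv z).1‖ := by linarith [D.s₀_lt, D.s₀_pos]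
      have := D.G_eq_smul hgt hx1 hw2
      rw [show ((D.Ginv z).1, (D.Ginv z).2) = D.Ginv z from rfl, D.G_Ginv hzN] at this
      rw [this, norm_smul_coe_sphere (norm_nonneg _)] at hzn
      linarith [D.s₀_pos]
  · exact D.χ_of_not_mem hzN

end Size

/-! ### The end clauses -/

section Clauses

variable {Y : Type*} [TopologicalSpace Y] [ChartedSpace (𝔼 3) Y]
  {jA : D.tube.complement → Y} {jB : ↥solidTorus → Y}

/-- **the near-end part of the collar**: `c(Y × (-∞, a]) = {z ∈ O | e^{-a} ≤ M z}` [folklore] -/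
theorem image_collar_le (hG : D.tube.IsSurgeryWith jA jB) (a : ℝ) :
    D.collar jA jB '' {p | p.2 ≤ a} = {z | z ∈ D.O ∧ Real.exp (-a) ≤ D.M z} := by
  ext z
  constructor
  · rintro ⟨p, hp, rfl⟩
    have hz : D.collar jA jB p ∈ D.region := D.collar_mem_region hG p
    refine ⟨D.region_subset_O hz, ?_⟩
    rw [D.M_eq_exp jA jB hz, D.collarInv_collar hG]
    exact Real.exp_le_exp.2 (neg_le_neg hp)
  · rintro ⟨hzO, hM⟩
    have hz : z ∈ D.region := by
      rw [O_eq] at hzO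
      rcases hzO with h | h
      · exact h
      · rw [D.M_eq_zero_of_mem_core h] at hM; exact absurd hM (not_le.2 (Real.exp_pos _))
    refine ⟨D.collarInv jA jB z, ?_, D.collar_collarInv hG hz⟩
    rw [D.M_eq_exp jA jB hz, Real.exp_le_exp, neg_le_neg_iff] at hM
    exact hM

/-- **the core together with the far part of the collar**: `K₀ ∪ c(Y × [a, ∞)) = {z ∈ O | M z ≤ e^{-a}}` [folklore] -/
theorem core_union_image_collar_ge (hG : D.tube.IsSurgeryWith jA jB) (a : ℝ) :
    D.core ∪ D.collar jA jB '' {p | a ≤ p.2} = {z | z ∈ D.O ∧ D.M z ≤ Real.exp (-a)} := by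
  ext z
  constructor
  · rintro (hc | ⟨p, hp, rfl⟩)
    · exact ⟨D.core_subset_O hc, by rw [D.M_eq_zero_of_mem_core hc]; exact (Real.exp_pos _).le⟩
    · have hz : D.collar jA jB p ∈ D.region := D.collar_mem_region hG p
      refine ⟨D.region_subset_O hz, ?_⟩
      rw [D.M_eq_exp jA jB hz, D.collarInv_collar hG]
      exact Real.exp_le_exp.2 (neg_le_neg hp)
  · rintro ⟨hzO, hM⟩
    rw [O_eq] at hzO
    rcases hzO with hz | hz
    · refine Or.inr ⟨D.collarInv jA jB z, ?_, D.collar_collarInv hG hz⟩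
      rw [D.M_eq_exp jA jB hz, Real.exp_le_exp, neg_le_neg_iff] at hM
      exact hM
    · exact Or.inl hz

/-- Relative closedness of a superlevel set of the size in the exterior [folklore] -/
theorem closure_setOf_le_M_inter {c : ℝ} : closure {z | z ∈ D.O ∧ c ≤ D.M z} ∩ D.O ⊆ {z | z ∈ D.O ∧ c ≤ D.M z} := by
  rintro z ⟨hz, hzO⟩
  refine ⟨hzO, ?_⟩
  obtain ⟨u, hu, hlim⟩ := mem_closure_iff_seq_limit.1 hz
  have hcont : ContinuousAt D.M z := (D.continuousOn_M z hzO).continuousAt (D.isOpen_O.mem_nhds hzO)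
  exact ge_of_tendsto (hcont.tendsto.comp hlim) (Filter.Eventually.of_forall fun n ↦ (hu n).2)

/-- Points of a sublevel set of the size stay in a ball of radius `< 1` [folklore] -/
theorem norm_le_of_M_le {a : ℝ} {z : 𝔼 4} (hz : z ∈ D.O) (hM : D.M z ≤ Real.exp (-a)) :
    ‖z‖ ≤ 1 - SliceCollar.Einv D.s₀ (Real.exp (-a)) := by
  have hℓ := SliceCollar.Einv_mem D.s₀_pos (Real.exp (-a))
  by_contra h
  rw [not_le] at h
  have h0 : 0 < 1 - ‖z‖ := by linarith [hz.1]
  have hlt : 1 - ‖z‖ < SliceCollar.Einv D.s₀ (Real.exp (-a)) := by linarith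
  have hE : Real.exp (-a) < SliceCollar.E D.s₀ (1 - ‖z‖) := by
    rw [← SliceCollar.E_Einv D.s₀ (Real.exp_pos (-a))]
    exact SliceCollar.E_lt_E h0 hlt hℓ.2.le
  have : SliceCollar.E D.s₀ (1 - ‖z‖) ≤ D.M z := le_add_of_nonneg_right (D.χ_nonneg z)
  linarith

/-- **a sublevel set of the size in the exterior is compact** (it stays away from the sphere, where
`E_{s₀}(1 - ‖z‖) → ∞`, and from the disc, where `E_1(‖w‖) → ∞`) [folklore] -/
theorem isCompact_setOf_M_le (a : ℝ) : IsCompact {z | z ∈ D.O ∧ D.M z ≤ Real.exp (-a)} := by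
  set S := {z | z ∈ D.O ∧ D.M z ≤ Real.exp (-a)} with hS
  have hℓ := SliceCollar.Einv_mem D.s₀_pos (Real.exp (-a))
  have hr := SliceCollar.Einv_mem one_pos (Real.exp (-a))
  have hbound : S ⊆ closedBall (0 : 𝔼 4) (1 - SliceCollar.Einv D.s₀ (Real.exp (-a))) := fun z hz ↦ by
    rw [mem_closedBall, dist_zero_right]; exact D.norm_le_of_M_le hz.1 hz.2
  refine Metric.isCompact_of_isClosed_isBounded ?_ (isBounded_closedBall.subset hbound)
  -- closedness: limit points lie in the exterior
  refine isClosed_of_closure_subset fun z hz ↦ ?_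
  obtain ⟨u, hu, hlim⟩ := mem_closure_iff_seq_limit.1 hz
  have hzn : ‖z‖ ≤ 1 - SliceCollar.Einv D.s₀ (Real.exp (-a)) := by
    have := isClosed_closedBall.closure_subset_iff.2 hbound hz
    rwa [mem_closedBall, dist_zero_right] at this
  have hz1 : ‖z‖ < 1 := by linarith [hℓ.1]
  have hzd : z ∉ D.disc := by
    rintro ⟨x, hx, hxz⟩
    rw [mem_closedBall, dist_zero_right] at hx
    rcases hx.lt_or_eq with hlt | heq
    · -- an interior disc point: nearby tube points have small `‖w‖`, hence huge size
      have hdom : ((x, (0 : 𝔼 2)) : (𝔼 2) × (𝔼 2)) ∈ (dom : Set ((𝔼 2) × (𝔼 2))) := mem_dom_iff.2 ⟨hlt, by simp⟩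
      have hzN : z ∈ D.N := ⟨(x, 0), hdom, by rw [D.apply_zero x (by simpa using hlt)]; exact hxz⟩
      have hGinv : D.Ginv z = (x, 0) := by
        rw [← hxz, ← D.apply_zero x (by simpa using hlt)]; exact D.Ginv_apply hdom
      have hco : Filter.Tendsto (fun n ↦ ‖(D.Ginv (u n)).2‖) Filter.atTop (𝓝 0) := by
        have h1 : ContinuousAt (fun z' ↦ ‖(D.Ginv z').2‖) z :=
          (continuous_norm.comp continuous_snd).continuousAt.comp (D.contDiffAt_Ginv hzN).continuousAt
        have := h1.tendsto.comp hlim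
        simp only [Function.comp_def, hGinv, norm_zero] at this
        exact this
      have hevN : ∀ᶠ n in Filter.atTop, u n ∈ D.N := hlim.eventually (D.isOpen_N.mem_nhds hzN)
      have hevw : ∀ᶠ n in Filter.atTop, ‖(D.Ginv (u n)).2‖ < SliceCollar.Einv 1 (Real.exp (-a)) :=
        hco.eventually (gt_mem_nhds hr.1)
      obtain ⟨n, hnN, hnw⟩ := (hevN.and hevw).exists
      obtain ⟨huO, huM⟩ := hu n
      have hw : (D.Ginv (u n)).2 ≠ 0 :=
        D.snd_ne_zero_of_not_mem_disc (D.Ginv_mem hnN) (by rw [D.G_Ginv hnN]; exact huO.2)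
      have hE : Real.exp (-a) < SliceCollar.E 1 ‖(D.Ginv (u n)).2‖ := by
        rw [← SliceCollar.E_Einv 1 (Real.exp_pos (-a))]
        exact SliceCollar.E_lt_E (norm_pos_iff.2 hw) hnw hr.2.le
      have : SliceCollar.E 1 ‖(D.Ginv (u n)).2‖ ≤ D.M (u n) := by
        rw [M, D.χ_of_mem hnN]; exact le_add_of_nonneg_left (SliceCollar.E_nonneg _ _)
      linarith
    · have := D.norm_g_of_norm_eq_one heq
      rw [hxz] at this
      linarith
  have hzO : z ∈ D.O := ⟨hz1, hzd⟩
  refine ⟨hzO, ?_⟩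
  have hcont : ContinuousAt D.M z := (D.continuousOn_M z hzO).continuousAt (D.isOpen_O.mem_nhds hzO)
  exact le_of_tendsto (hcont.tendsto.comp hlim) (Filter.Eventually.of_forall fun n ↦ (hu n).2)

end Clauses

/-! ### Packaging: the collar of the slice-disc exterior -/

section Packaging

variable {Y : Type*} [TopologicalSpace Y] [ChartedSpace (𝔼 3) Y]
  {jA : D.tube.complement → Y} {jB : ↥solidTorus → Y}

/-- Membership in the slice-disc exterior is membership in `O` [folklore] -/
theorem mem_exterior_iff {z : 𝔼 4} : z ∈ sliceDiscExterior D.g ↔ z ∈ D.O := by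
  rw [mem_sliceDiscExterior_iff, show closure (D.g '' 𝔻²) = D.disc from D.isClosed_disc.closure_eq]
  rfl

/-- **the collar with values in the exterior** [folklore] -/
def collarX (hG : D.tube.IsSurgeryWith jA jB) (p : Y × ℝ) : sliceDiscExterior D.g :=
  ⟨D.collar jA jB p, D.mem_exterior_iff.2 (D.region_subset_O (D.collar_mem_region hG p))⟩

/-- The collar with values in the exterior, as a point of `ℝ⁴`. [folklore] -/
@[simp] theorem coe_collarX (hG : D.tube.IsSurgeryWith jA jB) (p : Y × ℝ) : (D.collarX hG p : 𝔼 4) = D.collar jA jB p := rfl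

/-- **the collar as an open partial homeomorphism** `Y × ℝ ≅ (B̊⁴ ∖ Δ) ∖ K₀` [folklore] -/
def collarPH (hG : D.tube.IsSurgeryWith jA jB) : OpenPartialHomeomorph (Y × ℝ) (sliceDiscExterior D.g) where
  toFun := D.collarX hG
  invFun z := D.collarInv jA jB z
  source := univ
  target := {z | (z : 𝔼 4) ∉ D.core}
  map_source' p _ := (D.collar_mem_region hG p).2.2
  map_target' _ _ := mem_univ _
  left_inv' p _ := D.collarInv_collar hG p
  right_inv' z hz := by
    have hreg : (z : 𝔼 4) ∈ D.region := by
      have hO := D.mem_exterior_iff.1 z.2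
      exact ⟨hO.1, hO.2, hz⟩
    exact Subtype.ext (D.collar_collarInv hG hreg)
  open_source := isOpen_univ
  open_target := D.isClosed_core.isOpen_compl.preimage continuous_subtype_val
  continuousOn_toFun := ((D.contMDiff_collar hG).continuous.subtype_mk _).continuousOn
  continuousOn_invFun := by
    refine (D.contMDiffOn_collarInv hG).continuousOn.comp continuous_subtype_val.continuousOn fun z hz ↦ ?_
    have hO := D.mem_exterior_iff.1 z.2
    exact ⟨hO.1, hO.2, hz⟩

/-- The collar partial homeomorphism as a function. [folklore] -/
theorem collarPH_apply (hG : D.tube.IsSurgeryWith jA jB) (p : Y × ℝ) : (D.collarPH hG p : 𝔼 4) = D.collar jA jB p := rfl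

/-- The collar is defined on all of `Y × ℝ`. [folklore] -/
theorem collarPH_source (hG : D.tube.IsSurgeryWith jA jB) : (D.collarPH hG).source = univ := rfl

/-- The target of the collar is the complement of the core in the exterior. [folklore] -/
theorem collarPH_target (hG : D.tube.IsSurgeryWith jA jB) :
    (D.collarPH hG).target = {z : sliceDiscExterior D.g | (z : 𝔼 4) ∉ D.core} := rfl

/-- Target points have coordinates in the collar region [folklore] -/
theorem coe_mem_region_of_mem_target (hG : D.tube.IsSurgeryWith jA jB) {z : sliceDiscExterior D.g} (hz : z ∈ (D.collarPH hG).target) :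
    (z : 𝔼 4) ∈ D.region := by
  have hO := D.mem_exterior_iff.1 z.2
  exact ⟨hO.1, hO.2, hz⟩

/-- **the collar is smooth** [folklore] -/
theorem contMDiffOn_collarPH (hG : D.tube.IsSurgeryWith jA jB) :
    ContMDiffOn ((𝓡 3).prod 𝓘(ℝ, ℝ)) (𝓡 4) ∞ (D.collarPH hG) (D.collarPH hG).source := by
  intro p _
  refine ContMDiffAt.contMDiffWithinAt ?_
  rw [← ContMDiffAt.subtypeVal_comp_iff]
  exact (D.contMDiff_collar hG).contMDiffAt

/-- **the inverse collar is smooth** [folklore] -/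
theorem contMDiffOn_collarPH_symm (hG : D.tube.IsSurgeryWith jA jB) :
    ContMDiffOn (𝓡 4) ((𝓡 3).prod 𝓘(ℝ, ℝ)) ∞ (D.collarPH hG).symm (D.collarPH hG).target :=
  (D.contMDiffOn_collarInv hG).comp contMDiff_subtype_val.contMDiffOn fun _ hz ↦ D.coe_mem_region_of_mem_target hG hz

/-- **end clause 1**: `c(Y × (-∞, a])` is closed in the exterior [folklore] -/
theorem isClosed_image_collarPH_le (hG : D.tube.IsSurgeryWith jA jB) (a : ℝ) :
    IsClosed ((D.collarPH hG) '' {p | p.2 ≤ a}) := by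
  have heq : (D.collarPH hG) '' {p | p.2 ≤ a} =
      Subtype.val ⁻¹' closure {z | z ∈ D.O ∧ Real.exp (-a) ≤ D.M z} := by
    ext z
    have hzO : (z : 𝔼 4) ∈ D.O := D.mem_exterior_iff.1 z.2
    constructor
    · rintro ⟨p, hp, rfl⟩
      refine subset_closure ?_
      show D.collar jA jB p ∈ {z | z ∈ D.O ∧ Real.exp (-a) ≤ D.M z}
      rw [← D.image_collar_le hG a]; exact ⟨p, hp, rfl⟩
    · intro hz
      have hmem : (z : 𝔼 4) ∈ {z | z ∈ D.O ∧ Real.exp (-a) ≤ D.M z} := D.closure_setOf_le_M_inter ⟨hz, hzO⟩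
      rw [← D.image_collar_le hG a] at hmem
      obtain ⟨p, hp, hpz⟩ := hmem
      exact ⟨p, hp, Subtype.ext hpz⟩
  rw [heq]
  exact isClosed_closure.preimage continuous_subtype_val

/-- **end clause 2**: the core together with `c(Y × [a, ∞))` is compact [folklore] -/
theorem isCompact_compl_target_union_image (hG : D.tube.IsSurgeryWith jA jB) (a : ℝ) :
    IsCompact ((D.collarPH hG).targetᶜ ∪ (D.collarPH hG) '' {p | a ≤ p.2}) := by
  have heq : Subtype.val '' ((D.collarPH hG).targetᶜ ∪ (D.collarPH hG) '' {p | a ≤ p.2}) =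
      {z | z ∈ D.O ∧ D.M z ≤ Real.exp (-a)} := by
    rw [← D.core_union_image_collar_ge hG a]
    ext z
    constructor
    · rintro ⟨z', hz', rfl⟩
      rcases hz' with h | ⟨p, hp, rfl⟩
      · exact Or.inl (not_not.1 h)
      · exact Or.inr ⟨p, hp, rfl⟩
    · rintro (hz | ⟨p, hp, rfl⟩)
      · exact ⟨⟨z, D.mem_exterior_iff.2 (D.core_subset_O hz)⟩, Or.inl (not_not.2 hz), rfl⟩
      · exact ⟨D.collarX hG p, Or.inr ⟨p, hp, rfl⟩, rfl⟩
  rw [Topology.IsInducing.subtypeVal.isCompact_iff]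
  have := D.isCompact_setOf_M_le a
  rw [← heq] at this
  exact this

/-- **the end collar of the exterior of a conical slice disc with a framed conical tube**, for every
`0`-surgery presented with the tube of the datum [folklore] -/
theorem exists_endCollar (hG : D.tube.IsSurgeryWith jA jB) :
    ∃ c : OpenPartialHomeomorph (Y × ℝ) (sliceDiscExterior D.g), c.source = univ ∧
      ContMDiffOn ((𝓡 3).prod 𝓘(ℝ, ℝ)) (𝓡 4) ∞ c c.source ∧
      ContMDiffOn (𝓡 4) ((𝓡 3).prod 𝓘(ℝ, ℝ)) ∞ c.symm c.target ∧
      (∀ a : ℝ, IsClosed (c '' {p | p.2 ≤ a})) ∧ ∀ a : ℝ, IsCompact (c.targetᶜ ∪ c '' {p | a ≤ p.2}) :=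
  ⟨D.collarPH hG, rfl, D.contMDiffOn_collarPH hG, D.contMDiffOn_collarPH_symm hG, D.isClosed_image_collarPH_le hG,
    D.isCompact_compl_target_union_image hG⟩

end Packaging

end ConicalDiscTube

/-! ### Transport of end collars along a diffeomorphism of the open ball -/

section Transport

variable {K : Knot} {g g₁ : 𝔼 2 → 𝔼 4}

/-- For a slice disc, the points of `closure (g(𝔻²))` in the open ball are the points `g(D̊²)` [folklore] -/
theorem mem_closure_image_iff_of_isSliceDisc (hg : K.IsSliceDisc g) {z : 𝔼 4} (hz : ‖z‖ < 1) :
    z ∈ closure (g '' 𝔻²) ↔ z ∈ g '' ball (0 : 𝔼 2) 1 := by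
  have hclosed : IsClosed (g '' 𝔻²) :=
    ((isCompact_closedBall _ _).image_of_continuousOn hg.1.continuous.continuousOn).isClosed
  rw [hclosed.closure_eq]
  constructor
  · rintro ⟨x, hx, rfl⟩
    rw [mem_closedBall, dist_zero_right] at hx
    rcases hx.lt_or_eq with hlt | heq
    · exact ⟨x, by simpa using hlt, rfl⟩
    · -- boundary points go to the knot, of norm `1`
      have hx0 : x ≠ 0 := by rintro rfl; simp at heq
      have hmem : ‖x‖⁻¹ • x ∈ Metric.sphere (0 : 𝔼 2) 1 := by
        rw [mem_sphere_zero_iff_norm, norm_smul, norm_inv, norm_norm, inv_mul_cancel₀ (norm_ne_zero_iff.2 hx0)]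
      have := hg.2.2.2.2.2 ⟨‖x‖⁻¹ • x, hmem⟩
      simp only [heq, inv_one, one_smul] at this
      have hn : ‖g x‖ = 1 := by rw [this]; exact norm_eq_of_mem_sphere _
      linarith
  · rintro ⟨x, hx, rfl⟩
    exact ⟨x, ball_subset_closedBall hx, rfl⟩

/-- Membership in the exterior of a slice disc: in the open ball, off the image of the open disc. [folklore] -/
theorem mem_sliceDiscExterior_iff_of_isSliceDisc (hg : K.IsSliceDisc g) {z : 𝔼 4} :
    z ∈ sliceDiscExterior g ↔ ‖z‖ < 1 ∧ z ∉ g '' ball (0 : 𝔼 2) 1 := by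
  rw [mem_sliceDiscExterior_iff]
  constructor
  · rintro ⟨h1, h2⟩; exact ⟨h1, fun h ↦ h2 ((mem_closure_image_iff_of_isSliceDisc hg h1).2 h)⟩
  · rintro ⟨h1, h2⟩; exact ⟨h1, fun h ↦ h2 ((mem_closure_image_iff_of_isSliceDisc hg h1).1 h)⟩

variable (hg : K.IsSliceDisc g) (hg₁ : K.IsSliceDisc g₁) (Θ : OpenPartialHomeomorph (𝔼 4) (𝔼 4))
  (hsrc : Θ.source = ball 0 1) (htgt : Θ.target = ball 0 1)
  (himg : Θ '' (g '' ball (0 : 𝔼 2) 1) = g₁ '' ball (0 : 𝔼 2) 1)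

include hg hg₁ hsrc htgt himg

/-- `Θ` maps the exterior of `g` into the exterior of `g₁`. [folklore] -/
theorem mapsTo_exterior : MapsTo Θ (sliceDiscExterior g) (sliceDiscExterior g₁) := by
  intro z hz
  rw [SetLike.mem_coe, mem_sliceDiscExterior_iff_of_isSliceDisc hg] at hz
  rw [SetLike.mem_coe, mem_sliceDiscExterior_iff_of_isSliceDisc hg₁]
  have hzs : z ∈ Θ.source := by rw [hsrc]; simpa using hz.1
  refine ⟨by have := Θ.map_source hzs; rw [htgt] at this; simpa using this, fun h ↦ ?_⟩
  rw [← himg] at h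
  obtain ⟨y, hy, hyz⟩ := h
  have hys : y ∈ Θ.source := by
    rw [hsrc]; obtain ⟨x, hx, rfl⟩ := hy
    rw [mem_ball, dist_zero_right] at hx ⊢
    exact hg.2.2.2.1 x hx
  have := Θ.injOn hys hzs hyz
  exact hz.2 (this ▸ hy)

/-- `Θ` maps the exterior of `g` into the exterior of `g₁`. [folklore] -/
theorem mapsTo_exterior_symm : MapsTo Θ.symm (sliceDiscExterior g₁) (sliceDiscExterior g) := by
  intro z hz
  rw [SetLike.mem_coe, mem_sliceDiscExterior_iff_of_isSliceDisc hg₁] at hz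
  rw [SetLike.mem_coe, mem_sliceDiscExterior_iff_of_isSliceDisc hg]
  have hzt : z ∈ Θ.target := by rw [htgt]; simpa using hz.1
  refine ⟨by have := Θ.map_target hzt; rw [hsrc] at this; simpa using this, fun h ↦ hz.2 ?_⟩
  rw [← himg]
  exact ⟨Θ.symm z, h, Θ.right_inv hzt⟩

/-- **the homeomorphism of slice-disc exteriors** induced by the diffeomorphism `Θ` of the open ball [folklore] -/
def exteriorHomeomorph : sliceDiscExterior g ≃ₜ sliceDiscExterior g₁ where
  toFun z := ⟨Θ z, mapsTo_exterior hg hg₁ Θ hsrc htgt himg z.2⟩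
  invFun z := ⟨Θ.symm z, mapsTo_exterior_symm hg hg₁ Θ hsrc htgt himg z.2⟩
  left_inv z := Subtype.ext (Θ.left_inv (by rw [hsrc]; simpa using (mem_sliceDiscExterior_iff.1 z.2).1))
  right_inv z := Subtype.ext (Θ.right_inv (by rw [htgt]; simpa using (mem_sliceDiscExterior_iff.1 z.2).1))
  continuous_toFun := by
    refine Continuous.subtype_mk (Θ.continuousOn.comp_continuous continuous_subtype_val fun z ↦ ?_) _
    rw [hsrc]; simpa using (mem_sliceDiscExterior_iff.1 z.2).1
  continuous_invFun := by
    refine Continuous.subtype_mk (Θ.continuousOn_symm.comp_continuous continuous_subtype_val fun z ↦ ?_) _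
    rw [htgt]; simpa using (mem_sliceDiscExterior_iff.1 z.2).1

/-- The homeomorphism of exteriors as a function. [folklore] -/
theorem coe_exteriorHomeomorph (z : sliceDiscExterior g) : (exteriorHomeomorph hg hg₁ Θ hsrc htgt himg z : 𝔼 4) = Θ z := rfl

/-- The homeomorphism of exteriors as a function. [folklore] -/
theorem coe_exteriorHomeomorph_symm (z : sliceDiscExterior g₁) :
    ((exteriorHomeomorph hg hg₁ Θ hsrc htgt himg).symm z : 𝔼 4) = Θ.symm z := rfl

/-- The homeomorphism of exteriors is smooth when `Θ` is [folklore] -/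
theorem contMDiff_exteriorHomeomorph (hΘ : ContDiffOn ℝ ∞ Θ (ball 0 1)) :
    ContMDiff (𝓡 4) (𝓡 4) ∞ (exteriorHomeomorph hg hg₁ Θ hsrc htgt himg) := by
  intro z
  rw [← ContMDiffAt.subtypeVal_comp_iff]
  have hz : (z : 𝔼 4) ∈ ball (0 : 𝔼 4) 1 := by simpa using (mem_sliceDiscExterior_iff.1 z.2).1
  have h1 : ContMDiffAt (𝓡 4) (𝓡 4) ∞ Θ (z : 𝔼 4) := (hΘ.contDiffAt (isOpen_ball.mem_nhds hz)).contMDiffAt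
  exact h1.comp z contMDiff_subtype_val.contMDiffAt

/-- The inverse homeomorphism of exteriors is smooth when `Θ⁻¹` is [folklore] -/
theorem contMDiff_exteriorHomeomorph_symm (hΘs : ContDiffOn ℝ ∞ Θ.symm (ball 0 1)) :
    ContMDiff (𝓡 4) (𝓡 4) ∞ (exteriorHomeomorph hg hg₁ Θ hsrc htgt himg).symm := by
  intro z
  rw [← ContMDiffAt.subtypeVal_comp_iff]
  have hz : (z : 𝔼 4) ∈ ball (0 : 𝔼 4) 1 := by simpa using (mem_sliceDiscExterior_iff.1 z.2).1
  have h1 : ContMDiffAt (𝓡 4) (𝓡 4) ∞ Θ.symm (z : 𝔼 4) := (hΘs.contDiffAt (isOpen_ball.mem_nhds hz)).contMDiffAt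
  exact h1.comp z contMDiff_subtype_val.contMDiffAt

omit hg hg₁ hsrc htgt himg in
/-- **transport of an end collar along a diffeomorphism of exteriors** [folklore] -/
theorem exists_endCollar_of_homeomorph {Y : Type*} [TopologicalSpace Y] [ChartedSpace (𝔼 3) Y]
    (e : sliceDiscExterior g ≃ₜ sliceDiscExterior g₁) (he : ContMDiff (𝓡 4) (𝓡 4) ∞ e)
    (hes : ContMDiff (𝓡 4) (𝓡 4) ∞ e.symm)
    (h : ∃ c : OpenPartialHomeomorph (Y × ℝ) (sliceDiscExterior g₁), c.source = univ ∧
      ContMDiffOn ((𝓡 3).prod 𝓘(ℝ, ℝ)) (𝓡 4) ∞ c c.source ∧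
      ContMDiffOn (𝓡 4) ((𝓡 3).prod 𝓘(ℝ, ℝ)) ∞ c.symm c.target ∧
      (∀ a : ℝ, IsClosed (c '' {p | p.2 ≤ a})) ∧ ∀ a : ℝ, IsCompact (c.targetᶜ ∪ c '' {p | a ≤ p.2})) :
    ∃ c : OpenPartialHomeomorph (Y × ℝ) (sliceDiscExterior g), c.source = univ ∧
      ContMDiffOn ((𝓡 3).prod 𝓘(ℝ, ℝ)) (𝓡 4) ∞ c c.source ∧
      ContMDiffOn (𝓡 4) ((𝓡 3).prod 𝓘(ℝ, ℝ)) ∞ c.symm c.target ∧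
      (∀ a : ℝ, IsClosed (c '' {p | p.2 ≤ a})) ∧ ∀ a : ℝ, IsCompact (c.targetᶜ ∪ c '' {p | a ≤ p.2}) := by
  obtain ⟨c, hsrc, hc, hcs, hcl, hcpt⟩ := h
  refine ⟨c.transHomeomorph e.symm, ?_, ?_, ?_, ?_, ?_⟩
  · simp [hsrc]
  · -- `e⁻¹ ∘ c`
    rw [OpenPartialHomeomorph.transHomeomorph_source]
    exact hes.comp_contMDiffOn hc
  · -- `c⁻¹ ∘ e` on `e⁻¹(c.target)`
    rw [OpenPartialHomeomorph.transHomeomorph_target]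
    have : (c.transHomeomorph e.symm).symm = fun z ↦ c.symm (e z) := by
      ext z : 1; simp [OpenPartialHomeomorph.transHomeomorph_symm_apply]
    rw [this]
    refine hcs.comp he.contMDiffOn fun z hz ↦ ?_
    simpa using hz
  · intro a
    rw [show (c.transHomeomorph e.symm : Y × ℝ → sliceDiscExterior g) = e.symm ∘ c from rfl, image_comp]
    exact e.symm.isClosedMap _ (hcl a)
  · intro a
    have htgt : (c.transHomeomorph e.symm).target = e.symm '' c.target := by
      rw [OpenPartialHomeomorph.transHomeomorph_target, Homeomorph.symm_symm, ← Homeomorph.image_symm]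
    rw [htgt, show (c.transHomeomorph e.symm : Y × ℝ → sliceDiscExterior g) = e.symm ∘ c from rfl, image_comp,
      ← Set.image_compl_eq e.symm.bijective, ← image_union]
    exact (hcpt a).image e.symm.continuous

end Transport

/-! ### The end collar of a slice-disc exterior from the two normal-form facts -/

/-- **The end of the open slice-disc exterior is collared by the `0`-surgery**, from the conical normal
form of the slice disc: the named fact
`Literature.Topology.FourManifolds.Knot.IsSliceDisc.exists_endCollar_of_isIntegralSurgery_zero`
(`ZeroSurgeryHomotopyBallSliceConstruction.lean`; Manolescu–Piccirillo (2023), proof of Lemma 3.3: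
`∂V ≅ S³₀(K)` for `V = B⁴ ∖ ν(Δ)`) follows from the two classical named facts of
`SliceDiscEndCollarFacts.lean` — conical straightening of the slice disc by a diffeomorphism of the open
ball (`Knot.IsSliceDisc.exists_conical_diffeomorph`) and the framed conical tube of a conical slice disc,
whose boundary framing is the zero framing (`Knot.IsSliceDisc.exists_conicalTube_hasFraming_zero`) — by
the explicit collar `ConicalDiscTube.collarPH` of this file: the given `0`-surgery `Y` is presented with
the tube `ν` of the datum (`IsOpenGluing.surgeryRel_of_hasFraming`, uniqueness of tubular neighbourhoods of
a given framing), the collar of `B̊⁴ ∖ Δ₁` is transported to `B̊⁴ ∖ Δ` along the straightening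
diffeomorphism. [cite: ManolescuPiccirillo2023, §3.2 Def. 3.4] [cite: Kirby1989, Ch. I §2] -/
theorem Knot.IsSliceDisc.exists_endCollar_of_isIntegralSurgery_zero_of_facts
    (h₁ : Knot.IsSliceDisc.exists_conical_diffeomorph) (h₂ : Knot.IsSliceDisc.exists_conicalTube_hasFraming_zero) :
    Knot.IsSliceDisc.exists_endCollar_of_isIntegralSurgery_zero := by
  intro K Y _ _ hY g hg
  -- the conical normal form of the disc and its framed tube
  obtain ⟨g₁, s₁, Θ, hg₁, hs₁, hs₁1, hcone, hsrc, htgt, hΘ, hΘs, himg⟩ := h₁ K g hg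
  obtain ⟨ν, hν0, s₀, G, hs₀, hs₀1, hcd, hinj, hfd, hball, hzero, hconeG, hdeep⟩ := h₂ K g₁ s₁ hg₁ hs₁ hs₁1 hcone
  let D : ConicalDiscTube K :=
    { g := g₁, s₁ := s₁, s₀ := s₀, ν := ν, G := G, isSliceDisc := hg₁, s₀_pos := hs₀, s₀_lt := hs₀1, s₁_lt := hs₁1,
      hasFraming := hν0, g_cone := hcone, contDiffOn := hcd, injOn := hinj, injective_fderiv := hfd,
      maps_ball := hball, apply_zero := hzero, cone := hconeG, deep := hdeep }
  -- present the `0`-surgery `Y` with the tube `ν`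
  obtain ⟨ν₀, hν₀, hG₀⟩ := hY
  obtain ⟨jA, jB, hGW⟩ := IsOpenGluing.surgeryRel_of_hasFraming hG₀ hν₀ hν0
  have hG : D.tube.IsSurgeryWith jA jB := hGW
  -- the collar of `B̊⁴ ∖ Δ₁`, transported along `Θ`
  exact exists_endCollar_of_homeomorph (exteriorHomeomorph hg hg₁ Θ hsrc htgt himg)
    (contMDiff_exteriorHomeomorph hg hg₁ Θ hsrc htgt himg hΘ) (contMDiff_exteriorHomeomorph_symm hg hg₁ Θ hsrc htgt himg hΘs)
    (D.exists_endCollar hG)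

end Literature.Topology.FourManifolds
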